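import Literature.AlgebraicGeometry.Surfaces.K3SurfaceBuskinLeaves
import Literature.AlgebraicGeometry.Surfaces.K3HodgeTypesProofs
import Literature.AlgebraicGeometry.HodgeTheory.CorrespondenceActionOfGraph
import Literature.AlgebraicGeometry.HodgeTheory.GysinProjectionNonvanishing
import Literature.AlgebraicGeometry.HodgeTheory.ComplexGysinCorrespondence
import Literature.AlgebraicGeometry.HodgeTheory.CorrespondenceComposition
import Literature.AlgebraicGeometry.HodgeTheory.HodgeTypePullback
import Literature.AlgebraicGeometry.HodgeTheory.SupportedHodgeClassDescent
import Literature.AlgebraicGeometry.HodgeTheory.AlgebraicClassesExteriorProduct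
import Literature.AlgebraicGeometry.HodgeTheory.LefschetzOneOne
import Literature.AlgebraicTopology.SingularHomology.GysinMapSupportProofs
import HarnessLib

/-!
# Buskin's Prop. 6.2 for reflective isometries — proofs: reflections along ALGEBRAIC lattice classes
# are algebraic self-correspondences, and the reflective leaf on one marked K3 surface

Family `hodge`, layer `Literature/AlgebraicGeometry/Surfaces`. Companion (theorems only; no
definition, no named fact, D-0026) of `K3SurfaceBuskinLeaves`, towards its named fact
`Buskin2019_reflectiveHodgeIsometry_algebraic` — N. Buskin, *Every rational Hodge isometry between two
K3 surfaces is algebraic*, J. reine angew. Math. 755 (2019) (arXiv:1510.02852, held and read), §6.2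
Prop. 6.2 ("Every rational Hodge isometry of projective surfaces of cyclic type is algebraic") in the
case of the REFLECTIVE isometries `η⁻¹ ∘ s_v ∘ η'` between marked projective K3 surfaces that the
printed proof of Thm. 1.1 feeds it after Cartan–Dieudonné.

## Status of the leaf (triage, recorded for the reconciler)

The leaf is the irreducible geometric core of Thm. 1.1: the parent proof files (`K3SurfaceProofs`,
`K3CorrespondenceComposition`) already prove everything else of §6.2. Its printed proof is Prop. 6.1
(surjectivity of the forgetful map `𝓜̃_φ → 𝓜_φ`: starting from Mukai's example — a general K3 `S`,
the fine moduli space `M = M_h(v)` of stable bundles, a normalised universal sheaf `𝓔`, Thm. 2.1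
[Mukai 1987] and Lemma 2.2 — the Azumaya algebra `End 𝓔` is carried along generic twistor paths in the
moduli space `𝓜_φ` of marked Hodge-isometric pairs, §4, Prop. 4.17, as a hyperholomorphic bundle,
Verbitsky's Thm. 5.2 and Lemma 5.6), preceded by the composition with reflections `r_C` in
`(−2)`-curves `C`, "which are all algebraic", to reach the Kähler-cone condition of Def. 4.11. None of
Mukai's theorem, twistor families, hyperkähler metrics, slope-stability and hyperholomorphic transport,
or the algebraicity of Chern classes of (twisted) sheaves exists in the tree; the leaf is of size XL
and stays a named fact. This file proves, sorry-free, the part of the printed argument that the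
tree's Gysin formalism supports now:

* `corr_k3ReflectionC_of_mem_algebraicClasses` — **reflections along algebraic lattice classes are
  algebraic self-correspondences** (the step "reflections `r_C` for `(−2)`-curves `C`, which are all
  algebraic" of the proof of Prop. 6.2; cf. Huybrechts, *Lectures on K3 Surfaces*, Ch. 16 Example 3.4 (i)
  with Prop. 3.2: the spherical twist `T_{𝒪_C(−1)}` acts on cohomology by `s_{[C]}`; here, elementarily,
  `s_δ = [Δ − (2/(δ.δ)) δ × δ]_*`, Fulton Cor. 16.1.1 and Example 16.1.2 (a)): for a K3
  surface `S` with a marking `η` (cup product `=` K3 form `× p`), every lattice vector `v ∈ Λ` whose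
  class `η⁻¹(v)` lies in `algebraicClasses S 1 = N¹ H²(S(ℂ); ℂ)`, and EVERY orientation family `μ`,
  the operator `η⁻¹ ∘ s_v ∘ η` on `H²(S(ℂ); ℂ)` is `[γ]_*^μ = fst_*(snd^*(–) ∪ γ)` for the algebraic
  class `γ = Δ₊1 − (2/((v.v) d)) • (fst^* δ ∪ snd^* δ) ∈ N² H⁴((S ⊗ S)(ℂ); ℂ)`, `δ = η⁻¹(v)`,
  `d ≠ 0` the fibre integral of `p`. Ingredients, all the tree's: push–pull for graph classes
  (`[Δ₊ 1]_* = id`, Fulton Cor. 16.1.1 / Example 16.1.15; `HodgeTheory.corrAction_gysinGraph_one`,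
  `HodgeTheory.gysinGraph_one_mem_algebraicClasses` of `CorrespondenceActionOfGraph`), exterior
  products of algebraic classes
  (`HodgeTheory.cupProduct_map_fst_map_snd_mem_algebraicClasses`), the projection formula
  (`complexGysin_cup`), `H⁰ = ℂ · 1` (`exists_eq_smul_one`), Künneth spanning
  (`kunnethSpan_complexBetti`, for `d ≠ 0`: `complexGysin_fst_map_snd_self_ne_zero`), and
  `p ≠ 0` (`ne_zero_of_cupProduct_eq_k3Form_smul`).
* `Buskin2019_reflectiveHodgeIsometry_algebraic_self` — **the leaf in the self case**
  `(S', η', p', x') = (S, η, p, x)`, GRANTED the two EXISTING named facts `Huybrechts_K3_hodgeTypes_H2`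
  (the Hodge types on `H²` of a K3 surface) and `HodgeTheory.lefschetzOneOne_rational` (Lefschetz
  `(1,1)`): the reflective hypothesis `s_v(x) ∈ ℂ x` on ONE period point forces `(v.x) = 0`
  (`k3Form_eq_zero_of_k3ReflectionC_eq_smul`: otherwise `x ∈ ℂ v` would be isotropic and real), so
  `δ = η⁻¹(v)` is an integral class orthogonal to `σ = η⁻¹(x)` and to `σ̄` (markings are real,
  `conjClass_markingSymm`), hence of type `(1,1)`, hence algebraic, and the first theorem applies.
  (These are the steps of the parent's chain at which consecutive marked surfaces coincide.)

* `corr_map_of_hom`, `corr_marking_of_hom` — **graphs of morphisms between two K3 surfaces are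
  algebraic correspondences**: for `g : S ⟶ S'`, `g^* = [(𝟙, g)₊ 1]_*^μ` with `(𝟙, g)₊ 1` algebraic
  (push–pull with two targets, `corrAction_gysinLift_one`, `gysinLift_one_mem_algebraicClasses`); in
  marked form, a lattice operator `σ` with `η ∘ g^* = σ ∘ η'` gives the algebraic `η⁻¹ ∘ σ ∘ η'` — the
  Torelli case of Shafarevich's question recalled in Buskin's introduction (`Z_φ = [Γ_f]`).

* `exists_corr_map_iso`, `Buskin2019_reflectiveHodgeIsometry_algebraic_of_iso` — **transport
  along isomorphisms**: an algebraic self-correspondence of `S` precomposed with `f^*` for an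
  isomorphism `f : S ≅ S'` is an algebraic correspondence `S' ⊢ S` (flat pull-back along
  `S ◁ f⁻¹`, projection formula, `(S ◁ f⁻¹)_* 1 = c • 1`, `c ≠ 0`; no moving lemma), whence **the
  leaf for marked pairs isomorphic as marked surfaces** (`η ∘ f^* = η'`), granted the same two
  existing named facts — by global Torelli (absent) the case `(v.x') = 0` of the leaf up to sign and
  Weyl reflections.

* `corr_prod_k3ReflectionC_of_mem_algebraicClasses`,
  `Buskin2019_reflectiveHodgeIsometry_algebraic_of_torelliData` — **the Torelli situation**: words in
  reflections along algebraic lattice classes act through algebraic self-correspondences (WITHOUT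
  Lemma 6.3 / the moving lemma: a word is a finite-rank perturbation of the identity spanned by its
  vectors, `listProd_k3ReflectionC_eq_id_add_sum`, and such perturbations by algebraic classes are
  algebraic, `corr_id_add_sum_of_mem_algebraicClasses`), whence the leaf for marked pairs related by
  Torelli data `η ∘ f^* = ±(s_{u₁} ∘ ⋯ ∘ s_{u_k}) ∘ η'` (`f : S ≅ S'`, `uᵢ ⊥ x`), granted the two
  existing named facts `Huybrechts_K3_hodgeTypes_H2`, `lefschetzOneOne_rational`. With the global Torelli theorem for marked projective K3 surfaces (Huybrechts
  Ch. 7 Thm. 5.3, Ch. 8 Cor. 2.9; absent from the tree) this is the whole case `(v.x') = 0` of the leaf.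

* `corr_sum_smul_of_mem_algebraicClasses`, `corr_add_sum_smul_of_mem_algebraicClasses` — two K3
  surfaces: every finite-rank operator `y ↦ Σ aᵢⱼ (V'ⱼ.η'y) δᵢ` through algebraic classes
  ("a class in `NS(S) ⊗ NS(S')`") is an algebraic correspondence, and algebraic correspondences are
  stable under such perturbations (Fulton Example 16.1.2 (a); `complexGysin_fst_map_snd_ne_zero`).
* `corr_of_markedTorelliData`, `Buskin2019_reflectiveHodgeIsometry_algebraic_of_markedTorelliData` —
  the same from Torelli data RELATIVE TO any lattice operator `g` (`η ∘ f^* = ±w ∘ g ∘ η'`), in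
  particular `g = s_v`: by the strong global Torelli theorem (every integral Hodge isometry meeting the
  Kähler condition is `f^*`) this reduces to global Torelli ALL cases of the leaf with `s_v` INTEGRAL
  (`(v.v) = ±2`) or `(v.x') = 0`.

What is NOT here: the leaf for NON-INTEGRAL reflections `s_v` with `(v.x') ≠ 0` — Buskin's `n`-cyclic
isometries, `n ≥ 2`: Mukai's theorem and Prop. 6.1 (moduli spaces of sheaves, twistor paths,
hyperholomorphic transport) — and the global Torelli theorem for marked K3 surfaces itself,
`(−2)`-curves as such.

## References

* [Buskin2019] N. Buskin, Every rational Hodge isometry between two K3 surfaces is algebraic,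
  J. reine angew. Math. 755 (2019) 127–150 (arXiv:1510.02852): §6.2 Prop. 6.2 and its proof, Prop. 6.1,
  Thm. 2.1, Lemma 2.2, §3 Def. 3.1 / Example 3.2.
* [Huybrechts2016K3] D. Huybrechts, Lectures on K3 Surfaces, CUP 2016, Ch. 16 Prop. 3.2 and Example 3.4 (i)
  (the spherical twist in `𝒪_C(−1)`, `C ≃ ℙ¹`, acts on cohomology by the reflection `s_{[C]}`), Ch. 6
  Prop. 1.2 and Example 1.3 (i), Ch. 1 Prop. 3.5, Ch. 7 Thm. 5.3 (global Torelli), Ch. 8 Cor. 2.9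
  (the Weyl group and effective isometries).
* [Huybrechts2019] D. Huybrechts, Motives of isogenous K3 surfaces, Comment. Math. Helv. 94 (2019), §1.1
  ("reflective" Hodge isometries, Thm. 1.1).
* [Fulton1998] W. Fulton, Intersection Theory, 2nd ed., Springer 1998, §16.1 Cor. 16.1.1 (`[Δ_X]` is the
  unit), Def. 16.1.2 (`α_*`), Prop. 16.1.2 (c) (`(Γ_f)_* = f_*`), Example 16.1.2 (a) (degenerate
  correspondences `[V × W]`), Example 16.1.15 (homological correspondences; `Δ` acts as the identity).
* [FultonYoungTableaux1997] W. Fulton, Young Tableaux, CUP 1997, Appendix B §B.1 (3)–(6), §B.2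
  Exercise 5, §B.3.
* [HatcherAT2002] A. Hatcher, Algebraic Topology, CUP 2002, §3.2 Prop. 3.10, Thm. 3.11, Thm. 3.15,
  §3.3 Thm. 3.26.
* [VoisinHodgeI2002] C. Voisin, Hodge Theory and Complex Algebraic Geometry I, CUP 2002, Thm. 11.30
  (Lefschetz `(1,1)`), Cor. 6.12, §7.3.2 (pull-backs preserve Hodge types).
* [Hartshorne1977] R. Hartshorne, Algebraic Geometry, Springer 1977, III Prop. 9.5 (flat base change
  of dimension / codimension).
-/

noncomputable section

open CategoryTheory MonoidalCategory CartesianMonoidalCategory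
open Literature.AlgebraicTopology.SingularHomology
open Literature.LinearAlgebra.QuadraticForm
open Literature.AlgebraicGeometry.HodgeTheory

namespace Literature.AlgebraicGeometry.Surfaces

section ReflectionAlongAlgebraicClass

variable {μ : OrientationFamily} {S S' : Motives.SchemeOver ℂ}

/-! ### Cup-product bookkeeping on `S ⊗ S'` -/

/-- Pull-backs are multiplicative, `f^*(a ∪ b) = f^* a ∪ f^* b` (Hatcher Prop. 3.10, `cupProduct_map`),
in the `complexBetti.map` spelling. [cite: HatcherAT2002, §3.2 Prop. 3.10] -/
theorem complexBetti_map_cupProduct (f : S ⟶ S') {p q n : ℕ} (h : p + q = n)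
    (a : complexBetti S' p) (b : complexBetti S' q) :
    complexBetti.map f n (cupProduct h a b) =
      cupProduct h (complexBetti.map f p a) (complexBetti.map f q b) :=
  cupProduct_map _ h a b

/-- **`snd^* y ∪ (fst^* a ∪ snd^* b) = fst^* a ∪ snd^*(y ∪ b)`** on `(S ⊗ S')(ℂ)` whenever
`deg y · deg a` is even (associativity, graded commutativity `cupProduct_gradedComm_holds` with sign
`(−1)^{deg y · deg a} = 1`, and naturality of `∪` under `snd^*`). [cite: HatcherAT2002, §3.2 Prop. 3.10 and Thm. 3.11] -/
theorem cupProduct_map_snd_cupProduct_map_fst_map_snd {k i j m n l : ℕ} (hij : i + j = m) (hkm : k + m = n)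
    (hkj : k + j = l) (hil : i + l = n) (he : Even (k * i)) (y : complexBetti S' k)
    (a : complexBetti S i) (b : complexBetti S' j) :
    cupProduct hkm (complexBetti.map (snd S S') k y)
        (cupProduct hij (complexBetti.map (fst S S') i a) (complexBetti.map (snd S S') j b)) =
      cupProduct hil (complexBetti.map (fst S S') i a)
        (complexBetti.map (snd S S') l (cupProduct hkj y b)) := by
  rw [← cupProduct_assoc rfl hij (show k + i + j = n by omega) hkm,
    cupProduct_gradedComm_holds ℂ _ _ (show i + k = k + i by omega) (complexBetti.map (snd S S') k y),
    he.neg_one_pow, one_smul,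
    cupProduct_assoc (show i + k = k + i by omega) hkj (show k + i + j = n by omega) hil,
    complexBetti_map_cupProduct]

/-! ### The fibre integral of a top class of a surface does not vanish -/

/-- **`fst_*(snd^* q) ≠ 0` in `H⁰(S(ℂ); ℂ)` for every non-zero `q ∈ H⁴(S(ℂ); ℂ)`**, `S` a smooth
projective surface, at every orientation family: the diagonal class `Δ₊ 1 ∈ H⁴((S ⊗ S)(ℂ))` acts as
the identity on `H⁴(S(ℂ))` (push–pull; Fulton Cor. 16.1.1), `q = fst_*(snd^* q ∪ Δ₊1)`; expanding
`Δ₊ 1` in cross products `fst^* a ∪ snd^* b` (Künneth spanning, `kunnethSpan_complexBetti`),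
`fst_*(snd^* q ∪ fst^* a ∪ snd^* b) = a ∪ fst_*(snd^*(q ∪ b))` (projection formula) vanishes for
`deg b > 0` (`q ∪ b = 0` above the top degree) and is a multiple of `a ∪ fst_*(snd^* q)` for
`deg b = 0` (`H⁰ = ℂ · 1`); so `fst_*(snd^* q) = 0` would force `q = 0`.
[cite: Fulton1998, §16.1 Cor. 16.1.1 and Example 16.1.15] [cite: HatcherAT2002, §3.2 Thm. 3.15 and §3.3 Thm. 3.26]
[cite: FultonYoungTableaux1997, Appendix B §B.1 (5)–(6)] -/
theorem complexGysin_fst_map_snd_self_ne_zero (μ : OrientationFamily) (hS : Motives.IsSmoothProjective 2 S)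
    {q : complexBetti S (2 * 2)} (hq : q ≠ 0) :
    complexGysin μ (Motives.IsSmoothProjective.tensor_holds hS hS) hS (fst S S)
        (rfl : 2 * 2 + 2 * 2 = 0 + 2 * (2 + 2)) (complexBetti.map (snd S S) (2 * 2) q) ≠ 0 := by
  intro h0
  have hμ : μ.HasPoincareDuality := OrientationFamily.hasPoincareDuality μ
  have hSS := Motives.IsSmoothProjective.tensor_holds hS hS
  -- push–pull in degree `4`: `[Δ₊ 1]_* q = q`
  have hid : corrAction μ hS hS (rfl : 2 * 2 + 2 * 2 = 2 * 2 + 2 * 2)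
      (complexGysin μ hS hSS (lift (𝟙 S) (𝟙 S)) (show 0 + 2 * (2 + 2) = 2 * 2 + 2 * 2 from rfl)
        (singularCohomology.one ℂ (Motives.ComplexPoints S))) q = q := by
    rw [corrAction_gysinGraph_one hμ hS hS (𝟙 S) (𝟙 S) rfl rfl, LinearMap.comp_apply,
      complexBetti.map_id, ModuleCat.hom_id, LinearMap.id_apply, complexGysin_id hμ hS,
      LinearMap.id_apply]
  -- the linear form `γ ↦ fst_*(snd^* q ∪ γ)` kills every cross product, hence everything
  have hle : Submodule.span ℂ
      {v | ∃ (i j : ℕ) (h : i + j = 2 * 2) (b : complexBetti S i) (w : complexBetti S j),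
        v = cupProduct h (complexBetti.map (fst S S) i b) (complexBetti.map (snd S S) j w)} ≤
      LinearMap.ker ((corrAction μ hS hS (rfl : 2 * 2 + 2 * 2 = 2 * 2 + 2 * 2)).flip q) := by
    refine Submodule.span_le.2 ?_
    rintro _ ⟨i, j, hij, a, b, rfl⟩
    rw [SetLike.mem_coe, LinearMap.mem_ker, LinearMap.flip_apply, corrAction_apply]
    rcases Nat.eq_zero_or_pos j with rfl | hj
    · obtain rfl : i = 2 * 2 := by omega
      obtain ⟨s, rfl⟩ := exists_eq_smul_one μ hS b
      rw [map_smul, map_smul, map_smul, map_smul,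
        cupProduct_map_snd_cupProduct_map_fst_map_snd hij rfl (Nat.add_zero _) (rfl : 2 * 2 + 2 * 2 = 2 * 2 + 2 * 2) (by decide),
        cupProduct_one,
        complexGysin_cup hμ hSS hS (fst S S) rfl _ (rfl : 2 * 2 + 2 * 2 = 0 + 2 * (2 + 2))
          (rfl : 2 * 2 + 0 = 2 * 2) a,
        h0, map_zero, smul_zero]
    · rw [cupProduct_map_snd_cupProduct_map_fst_map_snd hij rfl rfl (show i + (2 * 2 + j) = 2 * 2 + 2 * 2 by omega) ⟨2 * i, by ring⟩]
      haveI := subsingleton_complexBetti hS (show 2 * 2 < 2 * 2 + j by omega)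
      rw [Subsingleton.elim (cupProduct (rfl : 2 * 2 + j = 2 * 2 + j) q b) 0, map_zero, map_zero, map_zero]
  have hmem := hle (kunnethSpan_complexBetti hS hS (2 * 2)
    (complexGysin μ hS hSS (lift (𝟙 S) (𝟙 S)) (show 0 + 2 * (2 + 2) = 2 * 2 + 2 * 2 from rfl)
      (singularCohomology.one ℂ (Motives.ComplexPoints S))))
  rw [LinearMap.mem_ker, LinearMap.flip_apply, hid] at hmem
  exact hq hmem

/-! ### The action of an exterior square `δ × δ'` -/

/-- **`[fst^* δ ∪ snd^* δ']_* y = δ ∪ fst_*(snd^*(y ∪ δ'))`** for classes `δ, δ', y ∈ H²(S(ℂ); ℂ)` of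
a smooth projective surface `S` (`snd^* y ∪ (fst^* δ ∪ snd^* δ') = fst^* δ ∪ snd^*(y ∪ δ')` and the
projection formula `fst_*(fst^* δ ∪ z) = δ ∪ fst_* z`, Fulton (6)): the correspondence `δ × δ'` acts
by `y ↦ (y.δ') δ` up to the fibre integral of the point class. [cite: FultonYoungTableaux1997, Appendix B §B.1 (3) and (6)]
[cite: Fulton1998, §16.1 Def. 16.1.2 and Example 16.1.2 (a)] -/
theorem corrAction_cupProduct_map_fst_map_snd (hS : Motives.IsSmoothProjective 2 S)
    (δ δ' y : complexBetti S (2 * 1)) :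
    corrAction μ hS hS (rfl : 2 * 1 + 2 * 2 = 2 * 1 + 2 * 2)
        (cupProduct (rfl : 2 * 1 + 2 * 1 = 2 * 2) (complexBetti.map (fst S S) (2 * 1) δ)
          (complexBetti.map (snd S S) (2 * 1) δ')) y =
      cupProduct (rfl : 2 * 1 + 0 = 2 * 1) δ
        (complexGysin μ (Motives.IsSmoothProjective.tensor_holds hS hS) hS (fst S S)
          (rfl : 2 * 2 + 2 * 2 = 0 + 2 * (2 + 2))
          (complexBetti.map (snd S S) (2 * 2) (cupProduct (rfl : 2 * 1 + 2 * 1 = 2 * 2) y δ'))) := by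
  have hμ : μ.HasPoincareDuality := OrientationFamily.hasPoincareDuality μ
  rw [corrAction_apply,
    cupProduct_map_snd_cupProduct_map_fst_map_snd rfl rfl rfl (rfl : 2 * 1 + 2 * 2 = 2 * 1 + 2 * 2) (by decide)]
  exact complexGysin_cup hμ (Motives.IsSmoothProjective.tensor_holds hS hS) hS (fst S S) rfl _ rfl
    rfl δ _


/-- Two-surface form of `corrAction_cupProduct_map_fst_map_snd`:
**`[fst^* δ ∪ snd^* δ']_* y = δ ∪ fst_*(snd^*(y ∪ δ'))`** for `δ ∈ H²(S(ℂ))`, `δ', y ∈ H²(S'(ℂ))`,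
`S`, `S'` smooth projective surfaces: the exterior product `δ × δ'`, a correspondence from `S'` to
`S`, acts by `y ↦ (∫_{S'} y ∪ δ') δ`. [cite: FultonYoungTableaux1997, Appendix B §B.1 (3) and (6)]
[cite: Fulton1998, §16.1 Def. 16.1.2 and Example 16.1.2 (a)] -/
theorem corrAction_cupProduct_map_fst_map_snd₂ (hS : Motives.IsSmoothProjective 2 S)
    (hS' : Motives.IsSmoothProjective 2 S') (δ : complexBetti S (2 * 1))
    (δ' y : complexBetti S' (2 * 1)) :
    corrAction μ hS hS' (rfl : 2 * 1 + 2 * 2 = 2 * 1 + 2 * 2)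
        (cupProduct (rfl : 2 * 1 + 2 * 1 = 2 * 2) (complexBetti.map (fst S S') (2 * 1) δ)
          (complexBetti.map (snd S S') (2 * 1) δ')) y =
      cupProduct (rfl : 2 * 1 + 0 = 2 * 1) δ
        (complexGysin μ (Motives.IsSmoothProjective.tensor_holds hS hS') hS (fst S S')
          (rfl : 2 * 2 + 2 * 2 = 0 + 2 * (2 + 2))
          (complexBetti.map (snd S S') (2 * 2) (cupProduct (rfl : 2 * 1 + 2 * 1 = 2 * 2) y δ'))) := by
  have hμ : μ.HasPoincareDuality := OrientationFamily.hasPoincareDuality μ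
  rw [corrAction_apply,
    cupProduct_map_snd_cupProduct_map_fst_map_snd rfl rfl rfl (rfl : 2 * 1 + 2 * 2 = 2 * 1 + 2 * 2) (by decide)]
  exact complexGysin_cup hμ (Motives.IsSmoothProjective.tensor_holds hS hS') hS (fst S S') rfl _ rfl
    rfl δ _

/-! ### Reflections along algebraic lattice classes are algebraic self-correspondences -/

/-- `MarkedK3[S, η, p, x]` (as in `K3SurfaceProofs` / `K3SurfaceBuskinLeaves`): a marked K3 surface
with period `x`. Local notation only. -/
local notation3 (prettyPrint := false) "MarkedK3[" S ", " η ", " p ", " x "]" =>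
  (HodgeTheory.IsIntegralClass p ∧
    (∀ q : HodgeTheory.complexBetti S (2 * 2), HodgeTheory.IsIntegralClass q → ∃ n : ℤ, q = n • p) ∧
    (∀ c : HodgeTheory.complexBetti S (2 * 1),
        HodgeTheory.IsIntegralClass c ↔ ∃ v : K3Index → ℤ, η c = fun i => (v i : ℂ)) ∧
    (∀ a b : HodgeTheory.complexBetti S (2 * 1),
        cupProduct (rfl : 2 * 1 + 2 * 1 = 2 * 2) a b = k3Form (η a) (η b) • p) ∧
    HodgeTheory.IsOfHodgeType 2 S (2 * 1) 2 0 (LinearEquiv.symm η x) ∧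
    (∀ τ : HodgeTheory.complexBetti S (2 * 1),
        HodgeTheory.IsOfHodgeType 2 S (2 * 1) 2 0 τ → ∃ t : ℂ, τ = t • LinearEquiv.symm η x))

/-- `PeriodPt[x]` (as in `K3SurfaceProofs`): a projective period point. Local notation only. -/
local notation3 (prettyPrint := false) "PeriodPt[" x "]" =>
  (k3Form x x = 0 ∧ 0 < (k3Form (star x) x).re ∧
    ∃ u : K3Index → ℤ, k3Form (fun i => (u i : ℂ)) x = 0 ∧ 0 < ∑ i, ∑ j, u i * k3Gram i j * u j)

/-- `Corr[μ, S, S', hS, hS' ; γ, y] = [γ]_* y = fst_* (snd^* y ∪ γ)` (as in `K3SurfaceProofs`):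
LITERALLY the expression in the conclusion of `Buskin2019_reflectiveHodgeIsometry_algebraic`. Local
notation only. -/
local notation3 (prettyPrint := false) "Corr[" μ ", " S ", " S' ", " hS ", " hS' " ; " γ ", " y "]" =>
  HodgeTheory.complexGysin μ
    (Motives.IsSmoothProjective.tensor_holds (IsK3Surface.isSmoothProjective hS)
      (IsK3Surface.isSmoothProjective hS'))
    (IsK3Surface.isSmoothProjective hS) (SemiCartesianMonoidalCategory.fst S S')
    (rfl : 2 * 1 + 2 * 2 + 2 * 2 = 2 * 1 + 2 * (2 + 2))
    (cupProduct (rfl : 2 * 1 + 2 * 2 = 2 * 1 + 2 * 2)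
      (HodgeTheory.complexBetti.map (SemiCartesianMonoidalCategory.snd S S') (2 * 1) y) γ)

/-- **Reflections along algebraic lattice classes are algebraic self-correspondences of a K3 surface**
(the step "reflections `r_C` for `(−2)`-curves `C`, which are all algebraic" of the proof of Buskin's
Prop. 6.2; cf. Huybrechts Ch. 16 Example 3.4 (i): `T^H_{𝒪_C(−1)} = s_{[C]}`; elementarily
`s_δ = [Δ − (2/(δ.δ)) δ × δ]_*` for algebraic `δ`, the diagonal being the unit and `δ × δ` a
degenerate correspondence, Fulton Cor. 16.1.1 and Example 16.1.2 (a)). For a K3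
surface `S`, a marking `η : H²(S(ℂ); ℂ) ≅ Λ_ℂ` with `a ∪ b = (ηa.ηb) p`, a lattice vector `v ∈ Λ`
whose class `δ = η⁻¹(v)` is algebraic (`δ ∈ N¹ H²(S(ℂ); ℂ)`), and every orientation family `μ`:
`η⁻¹ ∘ s_v ∘ η = [γ]_*^μ` on `H²(S(ℂ); ℂ)` for an algebraic `γ ∈ N² H⁴((S ⊗ S)(ℂ); ℂ)`, namely
`γ = Δ₊ 1 − (2/((v.v) d)) • (fst^* δ ∪ snd^* δ)` with `fst_*(snd^* p) = d • 1`, `d ≠ 0`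
(`complexGysin_fst_map_snd_self_ne_zero`, `p ≠ 0` by `ne_zero_of_cupProduct_eq_k3Form_smul`):
`[Δ₊ 1]_* = id` (push–pull), `Δ₊ 1` algebraic (graph classes), `fst^* δ ∪ snd^* δ` algebraic
(`cupProduct_map_fst_map_snd_mem_algebraicClasses`) acting by `y ↦ ((ηy.v) d) δ`
(`corrAction_cupProduct_map_fst_map_snd`), against `η⁻¹(s_v(η y)) = y − (2 (v.ηy)/(v.v)) δ`. For
isotropic `v` both sides are the identity (`2/0 = 0`), so no hypothesis `(v.v) ≠ 0` is needed.
[cite: Buskin2019, §6.2 proof of Prop. 6.2] [cite: Huybrechts2016K3, Ch. 16 Prop. 3.2 and Example 3.4 (i)]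
[cite: Fulton1998, §16.1 Cor. 16.1.1, Def. 16.1.2, Example 16.1.2 (a) and Example 16.1.15] -/
theorem corr_k3ReflectionC_of_mem_algebraicClasses (μ : OrientationFamily) (hS : IsK3Surface S)
    (η : complexBetti S (2 * 1) ≃ₗ[ℂ] (K3Index → ℂ)) (p : complexBetti S (2 * 2))
    (hcup : ∀ a b : complexBetti S (2 * 1),
      cupProduct (rfl : 2 * 1 + 2 * 1 = 2 * 2) a b = k3Form (η a) (η b) • p)
    (v : K3Index → ℤ) (halg : η.symm (fun i => (v i : ℂ)) ∈ algebraicClasses S 1) :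
    ∃ γ ∈ algebraicClasses (MonoidalCategoryStruct.tensorObj S S) 2,
      ∀ y : complexBetti S (2 * 1),
        η.symm (k3ReflectionC v (η y)) = Corr[μ, S, S, hS, hS ; γ, y] := by
  have hμ : μ.HasPoincareDuality := OrientationFamily.hasPoincareDuality μ
  have hSp : Motives.IsSmoothProjective 2 S := hS.isSmoothProjective
  have hSS := Motives.IsSmoothProjective.tensor_holds hSp hSp
  obtain ⟨w, hw⟩ : ∃ w : K3Index → ℂ, (fun i => (v i : ℂ)) = w := ⟨_, rfl⟩
  rw [hw] at halg
  obtain ⟨δ, hδ⟩ : ∃ δ : complexBetti S (2 * 1), η.symm w = δ := ⟨_, rfl⟩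
  rw [hδ] at halg
  have hηδ : η δ = w := by rw [← hδ, LinearEquiv.apply_symm_apply]
  have hp : p ≠ 0 := ne_zero_of_cupProduct_eq_k3Form_smul μ hSp η p hcup
  -- the fibre integral of `p`: `fst_*(snd^* p) = d • 1` with `d ≠ 0`
  obtain ⟨d, hd⟩ := exists_eq_smul_one μ hSp (complexGysin μ hSS hSp (fst S S)
    (rfl : 2 * 2 + 2 * 2 = 0 + 2 * (2 + 2)) (complexBetti.map (snd S S) (2 * 2) p))
  have hd0 : d ≠ 0 := by
    rintro rfl
    rw [zero_smul] at hd
    exact complexGysin_fst_map_snd_self_ne_zero μ hSp hp hd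
  -- the reflection in coordinates
  have hL : ∀ y : complexBetti S (2 * 1),
      η.symm (k3ReflectionC v (η y)) = y - (2 / k3Form w w * k3Form w (η y)) • δ := fun y => by
    rw [k3ReflectionC_apply, hw, map_sub, map_smul, LinearEquiv.symm_apply_apply, hδ]
  -- `[Δ₊ 1]_* = id`
  have hid : ∀ y : complexBetti S (2 * 1), corrAction μ hSp hSp (rfl : 2 * 1 + 2 * 2 = 2 * 1 + 2 * 2)
      (complexGysin μ hSp hSS (lift (𝟙 S) (𝟙 S)) (show 0 + 2 * (2 + 2) = 2 * 2 + 2 * 2 from rfl)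
        (singularCohomology.one ℂ (Motives.ComplexPoints S))) y = y := fun y => by
    rw [corrAction_gysinGraph_one hμ hSp hSp (𝟙 S) (𝟙 S) rfl rfl, LinearMap.comp_apply,
      complexBetti.map_id, ModuleCat.hom_id, LinearMap.id_apply, complexGysin_id hμ hSp,
      LinearMap.id_apply]
  -- `[fst^* δ ∪ snd^* δ]_* y = ((η y . w) d) δ`
  have hγ₂ : ∀ y : complexBetti S (2 * 1), corrAction μ hSp hSp (rfl : 2 * 1 + 2 * 2 = 2 * 1 + 2 * 2)
      (cupProduct (rfl : 2 * 1 + 2 * 1 = 2 * 2) (complexBetti.map (fst S S) (2 * 1) δ)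
        (complexBetti.map (snd S S) (2 * 1) δ)) y = (k3Form (η y) w * d) • δ := fun y => by
    rw [corrAction_cupProduct_map_fst_map_snd, hcup y δ, hηδ, map_smul, map_smul, hd, smul_smul,
      map_smul, cupProduct_one]
  have main : ∀ y : complexBetti S (2 * 1), corrAction μ hSp hSp (rfl : 2 * 1 + 2 * 2 = 2 * 1 + 2 * 2)
      (complexGysin μ hSp hSS (lift (𝟙 S) (𝟙 S)) (show 0 + 2 * (2 + 2) = 2 * 2 + 2 * 2 from rfl)
          (singularCohomology.one ℂ (Motives.ComplexPoints S)) -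
        (2 / k3Form w w / d) • cupProduct (rfl : 2 * 1 + 2 * 1 = 2 * 2)
          (complexBetti.map (fst S S) (2 * 1) δ) (complexBetti.map (snd S S) (2 * 1) δ)) y =
      y - (2 / k3Form w w * k3Form w (η y)) • δ := fun y => by
    rw [map_sub, map_smul, LinearMap.sub_apply, LinearMap.smul_apply, hid y, hγ₂ y, smul_smul,
      k3Form_comm (η y) w]
    congr 2
    rw [mul_comm (k3Form w (η y)) d, ← mul_assoc, div_mul_cancel₀ _ hd0]
  refine ⟨complexGysin μ hSp hSS (lift (𝟙 S) (𝟙 S)) (show 0 + 2 * (2 + 2) = 2 * 2 + 2 * 2 from rfl)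
          (singularCohomology.one ℂ (Motives.ComplexPoints S)) -
        (2 / k3Form w w / d) • cupProduct (rfl : 2 * 1 + 2 * 1 = 2 * 2)
          (complexBetti.map (fst S S) (2 * 1) δ) (complexBetti.map (snd S S) (2 * 1) δ), ?_, ?_⟩
  · have h₁ : complexGysin μ hSp hSS (lift (𝟙 S) (𝟙 S)) (show 0 + 2 * (2 + 2) = 2 * 2 + 2 * 2 from rfl)
        (singularCohomology.one ℂ (Motives.ComplexPoints S)) ∈ algebraicClasses (S ⊗ S) 2 :=
      gysinGraph_one_mem_algebraicClasses μ hμ hSp hSp (𝟙 S) (𝟙 S) (e := 2) rfl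
    have h₂ := cupProduct_map_fst_map_snd_mem_algebraicClasses hSp hSp halg halg
    have h₂' : cupProduct (rfl : 2 * 1 + 2 * 1 = 2 * 2) (complexBetti.map (fst S S) (2 * 1) δ)
        (complexBetti.map (snd S S) (2 * 1) δ) ∈ algebraicClasses (S ⊗ S) 2 := h₂
    exact Submodule.sub_mem _ h₁ (Submodule.smul_mem _ _ h₂')
  · intro y
    rw [hL y, ← main y]
    exact corrAction_apply μ hSp hSp _ _ y

end ReflectionAlongAlgebraicClass

section SelfCase

variable {S : Motives.SchemeOver ℂ}

/-- `MarkedK3[S, η, p, x]` (as in `K3SurfaceProofs` / `K3SurfaceBuskinLeaves`): a marked K3 surface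
with period `x`. Local notation only. -/
local notation3 (prettyPrint := false) "MarkedK3[" S ", " η ", " p ", " x "]" =>
  (HodgeTheory.IsIntegralClass p ∧
    (∀ q : HodgeTheory.complexBetti S (2 * 2), HodgeTheory.IsIntegralClass q → ∃ n : ℤ, q = n • p) ∧
    (∀ c : HodgeTheory.complexBetti S (2 * 1),
        HodgeTheory.IsIntegralClass c ↔ ∃ v : K3Index → ℤ, η c = fun i => (v i : ℂ)) ∧
    (∀ a b : HodgeTheory.complexBetti S (2 * 1),
        cupProduct (rfl : 2 * 1 + 2 * 1 = 2 * 2) a b = k3Form (η a) (η b) • p) ∧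
    HodgeTheory.IsOfHodgeType 2 S (2 * 1) 2 0 (LinearEquiv.symm η x) ∧
    (∀ τ : HodgeTheory.complexBetti S (2 * 1),
        HodgeTheory.IsOfHodgeType 2 S (2 * 1) 2 0 τ → ∃ t : ℂ, τ = t • LinearEquiv.symm η x))

/-- `PeriodPt[x]` (as in `K3SurfaceProofs`): a projective period point. Local notation only. -/
local notation3 (prettyPrint := false) "PeriodPt[" x "]" =>
  (k3Form x x = 0 ∧ 0 < (k3Form (star x) x).re ∧
    ∃ u : K3Index → ℤ, k3Form (fun i => (u i : ℂ)) x = 0 ∧ 0 < ∑ i, ∑ j, u i * k3Gram i j * u j)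

/-- `Corr[μ, S, S', hS, hS' ; γ, y] = [γ]_* y = fst_* (snd^* y ∪ γ)` (as in `K3SurfaceProofs`):
LITERALLY the expression in the conclusion of `Buskin2019_reflectiveHodgeIsometry_algebraic`. Local
notation only. -/
local notation3 (prettyPrint := false) "Corr[" μ ", " S ", " S' ", " hS ", " hS' " ; " γ ", " y "]" =>
  HodgeTheory.complexGysin μ
    (Motives.IsSmoothProjective.tensor_holds (IsK3Surface.isSmoothProjective hS)
      (IsK3Surface.isSmoothProjective hS'))
    (IsK3Surface.isSmoothProjective hS) (SemiCartesianMonoidalCategory.fst S S')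
    (rfl : 2 * 1 + 2 * 2 + 2 * 2 = 2 * 1 + 2 * (2 + 2))
    (cupProduct (rfl : 2 * 1 + 2 * 2 = 2 * 1 + 2 * 2)
      (HodgeTheory.complexBetti.map (SemiCartesianMonoidalCategory.snd S S') (2 * 1) y) γ)

/-- **The reflective hypothesis on one period point forces orthogonality**: if `(x.x) = 0`,
`(v.v) ≠ 0` and `s_v(x) = t x`, then `(v.x) = 0`. Indeed `(1 − t) x = c v` with
`c = 2 (v.x)/(v.v)`; if `(v.x) ≠ 0` then `c ≠ 0`, so either `t = 1` and `v = 0`, or `x = e v` with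
`e ≠ 0` and `0 = (x.x) = e² (v.v) ≠ 0`. (For a period point, `(x̄.x) > 0` is not even needed.)
[cite: Buskin2019, §3 Example 3.2 and §6.2] [cite: Huybrechts2016K3, Ch. 6 §1.1] -/
theorem k3Form_eq_zero_of_k3ReflectionC_eq_smul {x : K3Index → ℂ} (hxx : k3Form x x = 0)
    {v : K3Index → ℤ} (hv : ∑ i, ∑ j, v i * k3Gram i j * v j ≠ 0)
    (ht : ∃ t : ℂ, k3ReflectionC v x = t • x) :
    k3Form (fun i => (v i : ℂ)) x = 0 := by
  obtain ⟨t, ht⟩ := ht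
  obtain ⟨w, hw⟩ : ∃ w : K3Index → ℂ, (fun i => (v i : ℂ)) = w := ⟨_, rfl⟩
  have hww : k3Form w w ≠ 0 := by
    rw [← hw, k3Form_intCast]
    exact_mod_cast hv
  rw [k3ReflectionC_apply, hw] at ht
  rw [hw]
  by_contra hvx
  have hc : 2 / k3Form w w * k3Form w x ≠ 0 := mul_ne_zero (div_ne_zero two_ne_zero hww) hvx
  -- `(1 - t) x = c w`
  have hxw : (1 - t) • x = (2 / k3Form w w * k3Form w x) • w := by
    rw [sub_smul, one_smul, sub_eq_iff_eq_add, ← sub_eq_iff_eq_add', ht]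
  by_cases h1 : t = 1
  · rw [h1, sub_self, zero_smul] at hxw
    have hw0 : w = 0 := by
      rcases smul_eq_zero.1 hxw.symm with h | h
      · exact absurd h hc
      · exact h
    exact hvx (by rw [hw0, k3Form_zero_left])
  · have h1t : (1 - t) ≠ 0 := sub_ne_zero.2 (Ne.symm h1)
    have hx : x = ((1 - t)⁻¹ * (2 / k3Form w w * k3Form w x)) • w := by
      rw [← smul_smul, ← hxw, smul_smul, inv_mul_cancel₀ h1t, one_smul]
    apply hww
    have h0 := hxx
    rw [hx, k3Form_smul_left, k3Form_smul_right, ← mul_assoc] at h0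
    rcases mul_eq_zero.1 h0 with h | h
    · exact absurd h (mul_ne_zero (mul_ne_zero (inv_ne_zero h1t) hc) (mul_ne_zero (inv_ne_zero h1t) hc))
    · exact h

/-- **Buskin's Prop. 6.2 for reflective isometries, self case** — the named fact
`Buskin2019_reflectiveHodgeIsometry_algebraic` with `(S', η', p', x') = (S, η, p, x)`, GRANTED the
existing named facts `Huybrechts_K3_hodgeTypes_H2` (Huybrechts Ch. 6 Prop. 1.2 / Ex. 1.3 (i): the
`(1,1)`-classes of a K3 surface are `σ^⊥ ∩ σ̄^⊥`) and `HodgeTheory.lefschetzOneOne_rational` (Voisin I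
Thm. 11.30). For a marked projective K3 surface `(S, η, p, x)`, a non-isotropic `v ∈ Λ` with
`s_v(x) ∈ ℂ x`, and every orientation family `μ`, the Hodge isometry `η⁻¹ ∘ s_v ∘ η` of
`H²(S(ℂ); ℂ)` is `[γ]_*^μ` for an algebraic `γ ∈ N² H⁴((S ⊗ S)(ℂ); ℂ)`: `(v.x) = 0`
(`k3Form_eq_zero_of_k3ReflectionC_eq_smul`), so the integral class `δ = η⁻¹(v)` satisfies
`δ ∪ σ = (v.x) p = 0` and `δ ∪ σ̄ = (v.x̄) p = 0` for `σ = η⁻¹(x) ≠ 0` (markings are real,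
`conjClass_markingSymm`), hence is of type `(1,1)`, hence algebraic (Lefschetz `(1,1)`, integral
classes being rational), and `corr_k3ReflectionC_of_mem_algebraicClasses` applies. This is the
reflective leaf at the steps of the parent's chain of marked K3 surfaces where two consecutive
surfaces coincide; the general leaf (two different marked surfaces) is Buskin's Prop. 6.1 and is
not formalised. [cite: Buskin2019, §6.2 Prop. 6.2 and proof of Thm. 1.1]
[cite: Huybrechts2019, §1.1 Thm. 1.1]
[cite: Huybrechts2016K3, Ch. 6 Prop. 1.2 and Example 1.3 (i); Ch. 16 Example 3.4 (i)]
[cite: VoisinHodgeI2002, Thm. 11.30] -/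
theorem Buskin2019_reflectiveHodgeIsometry_algebraic_self
    (hH : Huybrechts_K3_hodgeTypes_H2) (hL11 : lefschetzOneOne_rational)
    (μ : OrientationFamily) (S : Motives.SchemeOver ℂ) (hS : IsK3Surface S)
    (η : complexBetti S (2 * 1) ≃ₗ[ℂ] (K3Index → ℂ)) (p : complexBetti S (2 * 2))
    (x : K3Index → ℂ) :
    MarkedK3[S, η, p, x] → PeriodPt[x] →
    ∀ v : K3Index → ℤ, ∑ i, ∑ j, v i * k3Gram i j * v j ≠ 0 →
    (∃ t : ℂ, k3ReflectionC v x = t • x) →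
    ∃ γ ∈ algebraicClasses (MonoidalCategoryStruct.tensorObj S S) 2,
      ∀ y : complexBetti S (2 * 1),
        η.symm (k3ReflectionC v (η y)) = Corr[μ, S, S, hS, hS ; γ, y] := by
  intro hm hx v hv ht
  obtain ⟨-, -, hint, hcup, hσ, -⟩ := hm
  have hvx : k3Form (fun i => (v i : ℂ)) x = 0 := k3Form_eq_zero_of_k3ReflectionC_eq_smul hx.1 hv ht
  have hp : p ≠ 0 := ne_zero_of_cupProduct_eq_k3Form_smul μ hS.isSmoothProjective η p hcup
  -- the lattice class `δ = η⁻¹ v` is integral, orthogonal to `σ = η⁻¹ x` and to `σ̄`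
  have hδint : IsIntegralClass (η.symm fun i => (v i : ℂ)) := (hint _).2 ⟨v, η.apply_symm_apply _⟩
  have hx0 : x ≠ 0 := by
    rintro rfl
    have h := hx.2.1
    rw [k3Form_zero_right, Complex.zero_re] at h
    exact lt_irrefl _ h
  have hσ0 : η.symm x ≠ 0 := fun h => hx0 (by simpa using congrArg η h)
  have h1 : cupProduct (rfl : 2 * 1 + 2 * 1 = 2 * 2) (η.symm fun i => (v i : ℂ)) (η.symm x) = 0 := by
    rw [hcup, η.apply_symm_apply, η.apply_symm_apply, hvx, zero_smul]
  have h2 : cupProduct (rfl : 2 * 1 + 2 * 1 = 2 * 2) (η.symm fun i => (v i : ℂ))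
      (conjClass (Motives.ComplexPoints S) (2 * 1) (η.symm x)) = 0 := by
    have hreal : star (fun i => (v i : ℂ)) = fun i => (v i : ℂ) := by
      funext i; simp only [Pi.star_apply, star_intCast]
    rw [conjClass_markingSymm η hint, hcup, η.apply_symm_apply, η.apply_symm_apply, ← hreal,
      ← star_k3Form, hvx, star_zero, zero_smul]
  have h11 : IsOfHodgeType 2 S (2 * 1) 1 1 (η.symm fun i => (v i : ℂ)) :=
    ((hH S hS _ hσ hσ0).2.2 _).2 ⟨h1, h2⟩
  have halg : η.symm (fun i => (v i : ℂ)) ∈ algebraicClasses S 1 :=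
    hL11 hS.isSmoothProjective _ hδint.isRationalClass h11
  exact corr_k3ReflectionC_of_mem_algebraicClasses μ hS η p hcup v halg

end SelfCase

section FiniteRank

variable {μ : OrientationFamily} {S : Motives.SchemeOver ℂ}

/-! ### Finite-rank perturbations of the identity; words in reflections without the moving lemma -/

/-- `Corr[μ, S, S', hS, hS' ; γ, y] = [γ]_* y = fst_* (snd^* y ∪ γ)` (as in `K3SurfaceProofs`):
LITERALLY the expression in the conclusion of `Buskin2019_reflectiveHodgeIsometry_algebraic`. Local
notation only. -/
local notation3 (prettyPrint := false) "Corr[" μ ", " S ", " S' ", " hS ", " hS' " ; " γ ", " y "]" =>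
  HodgeTheory.complexGysin μ
    (Motives.IsSmoothProjective.tensor_holds (IsK3Surface.isSmoothProjective hS)
      (IsK3Surface.isSmoothProjective hS'))
    (IsK3Surface.isSmoothProjective hS) (SemiCartesianMonoidalCategory.fst S S')
    (rfl : 2 * 1 + 2 * 2 + 2 * 2 = 2 * 1 + 2 * (2 + 2))
    (cupProduct (rfl : 2 * 1 + 2 * 2 = 2 * 1 + 2 * 2)
      (HodgeTheory.complexBetti.map (SemiCartesianMonoidalCategory.snd S S') (2 * 1) y) γ)


/-- The K3 form is additive over finite sums in the second variable. [cite: Huybrechts2016K3, Ch. 6 §1.1] -/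
theorem k3Form_sum_right {ι : Type*} (s : Finset ι) (a : K3Index → ℂ) (f : ι → K3Index → ℂ) :
    k3Form a (∑ i ∈ s, f i) = ∑ i ∈ s, k3Form a (f i) := by
  classical
  induction s using Finset.induction_on with
  | empty => simp
  | insert i s hi ih => rw [Finset.sum_insert hi, Finset.sum_insert hi, k3Form_add_right, ih]

/-- **Finite-rank perturbations of the identity by algebraic lattice classes are algebraic
self-correspondences** (Fulton §16.1: `[Δ_X]` is the unit, Cor. 16.1.1, and the classes `[V × W]` are
the degenerate correspondences, Example 16.1.2 (a)): for a K3 surface `S` with a marking `η`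
(`a ∪ b = (ηa.ηb) p`), lattice-side vectors `V₁, …, V_n ∈ Λ_ℂ` whose classes `η⁻¹(Vᵢ)` are algebraic,
coefficients `aᵢⱼ ∈ ℂ` and every orientation family `μ`, the operator
`y ↦ y + Σᵢⱼ aᵢⱼ (Vⱼ.ηy) η⁻¹(Vᵢ)` on `H²(S(ℂ); ℂ)` is `[γ]_*^μ` with the ALGEBRAIC
`γ = Δ₊1 + Σᵢⱼ (aᵢⱼ/d) • (fst^* η⁻¹(Vᵢ) ∪ snd^* η⁻¹(Vⱼ)) ∈ N² H⁴((S ⊗ S)(ℂ); ℂ)` (`[Δ₊1]_* = id`;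
`fst^* δ ∪ snd^* δ'` acts by `y ↦ ((ηy.ηδ') d) δ`, `corrAction_cupProduct_map_fst_map_snd`; exterior
products of algebraic classes are algebraic; `d ≠ 0` the fibre integral of `p`). No moving lemma.
[cite: Fulton1998, §16.1 Cor. 16.1.1, Def. 16.1.2 and Example 16.1.2 (a)]
[cite: FultonYoungTableaux1997, Appendix B §B.1 (3) and (6)] -/
theorem corr_id_add_sum_of_mem_algebraicClasses (μ : OrientationFamily) (hS : IsK3Surface S)
    (η : complexBetti S (2 * 1) ≃ₗ[ℂ] (K3Index → ℂ)) (p : complexBetti S (2 * 2))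
    (hcup : ∀ a b : complexBetti S (2 * 1),
      cupProduct (rfl : 2 * 1 + 2 * 1 = 2 * 2) a b = k3Form (η a) (η b) • p)
    {ι : Type} [Fintype ι] (V : ι → K3Index → ℂ) (halg : ∀ i, η.symm (V i) ∈ algebraicClasses S 1)
    (a : ι → ι → ℂ) :
    ∃ γ ∈ algebraicClasses (MonoidalCategoryStruct.tensorObj S S) 2,
      ∀ y : complexBetti S (2 * 1),
        y + ∑ i, ∑ j, (a i j * k3Form (V j) (η y)) • η.symm (V i) = Corr[μ, S, S, hS, hS ; γ, y] := by
  have hμ : μ.HasPoincareDuality := OrientationFamily.hasPoincareDuality μ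
  have hSp : Motives.IsSmoothProjective 2 S := hS.isSmoothProjective
  have hSS := Motives.IsSmoothProjective.tensor_holds hSp hSp
  have hp : p ≠ 0 := ne_zero_of_cupProduct_eq_k3Form_smul μ hSp η p hcup
  obtain ⟨d, hd⟩ := exists_eq_smul_one μ hSp (complexGysin μ hSS hSp (fst S S)
    (rfl : 2 * 2 + 2 * 2 = 0 + 2 * (2 + 2)) (complexBetti.map (snd S S) (2 * 2) p))
  have hd0 : d ≠ 0 := by
    rintro rfl
    rw [zero_smul] at hd
    exact complexGysin_fst_map_snd_self_ne_zero μ hSp hp hd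
  have hid : ∀ y : complexBetti S (2 * 1), corrAction μ hSp hSp (rfl : 2 * 1 + 2 * 2 = 2 * 1 + 2 * 2)
      (complexGysin μ hSp hSS (lift (𝟙 S) (𝟙 S)) (show 0 + 2 * (2 + 2) = 2 * 2 + 2 * 2 from rfl)
        (singularCohomology.one ℂ (Motives.ComplexPoints S))) y = y := fun y => by
    rw [corrAction_gysinGraph_one hμ hSp hSp (𝟙 S) (𝟙 S) rfl rfl, LinearMap.comp_apply,
      complexBetti.map_id, ModuleCat.hom_id, LinearMap.id_apply, complexGysin_id hμ hSp,
      LinearMap.id_apply]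
  have hγ₂ : ∀ (i j : ι) (y : complexBetti S (2 * 1)),
      corrAction μ hSp hSp (rfl : 2 * 1 + 2 * 2 = 2 * 1 + 2 * 2)
        (cupProduct (rfl : 2 * 1 + 2 * 1 = 2 * 2) (complexBetti.map (fst S S) (2 * 1) (η.symm (V i)))
          (complexBetti.map (snd S S) (2 * 1) (η.symm (V j)))) y =
        (k3Form (η y) (V j) * d) • η.symm (V i) := fun i j y => by
    rw [corrAction_cupProduct_map_fst_map_snd, hcup y, η.apply_symm_apply, map_smul, map_smul, hd,
      smul_smul, map_smul, cupProduct_one]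
  have hmem : ∀ i j : ι, cupProduct (rfl : 2 * 1 + 2 * 1 = 2 * 2)
      (complexBetti.map (fst S S) (2 * 1) (η.symm (V i)))
      (complexBetti.map (snd S S) (2 * 1) (η.symm (V j))) ∈
        algebraicClasses (MonoidalCategoryStruct.tensorObj S S) 2 := fun i j => by
    have h := cupProduct_map_fst_map_snd_mem_algebraicClasses hSp hSp (halg i) (halg j)
    exact h
  have h₁ : complexGysin μ hSp hSS (lift (𝟙 S) (𝟙 S)) (show 0 + 2 * (2 + 2) = 2 * 2 + 2 * 2 from rfl)
      (singularCohomology.one ℂ (Motives.ComplexPoints S)) ∈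
        algebraicClasses (MonoidalCategoryStruct.tensorObj S S) 2 :=
    gysinGraph_one_mem_algebraicClasses μ hμ hSp hSp (𝟙 S) (𝟙 S) (e := 2) rfl
  have main : ∀ y : complexBetti S (2 * 1), corrAction μ hSp hSp (rfl : 2 * 1 + 2 * 2 = 2 * 1 + 2 * 2)
      (complexGysin μ hSp hSS (lift (𝟙 S) (𝟙 S)) (show 0 + 2 * (2 + 2) = 2 * 2 + 2 * 2 from rfl)
          (singularCohomology.one ℂ (Motives.ComplexPoints S)) +
        ∑ i, ∑ j, (a i j / d) • cupProduct (rfl : 2 * 1 + 2 * 1 = 2 * 2)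
          (complexBetti.map (fst S S) (2 * 1) (η.symm (V i)))
          (complexBetti.map (snd S S) (2 * 1) (η.symm (V j)))) y =
      y + ∑ i, ∑ j, (a i j * k3Form (V j) (η y)) • η.symm (V i) := fun y => by
    rw [map_add, LinearMap.add_apply, hid y]
    simp only [map_sum, map_smul, LinearMap.sum_apply, LinearMap.smul_apply, hγ₂, smul_smul]
    congr 1
    refine Finset.sum_congr rfl fun i _ => Finset.sum_congr rfl fun j _ => ?_
    rw [k3Form_comm (η y) (V j)]
    congr 1
    field_simp
  refine ⟨complexGysin μ hSp hSS (lift (𝟙 S) (𝟙 S)) (show 0 + 2 * (2 + 2) = 2 * 2 + 2 * 2 from rfl)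
        (singularCohomology.one ℂ (Motives.ComplexPoints S)) +
      ∑ i, ∑ j, (a i j / d) • cupProduct (rfl : 2 * 1 + 2 * 1 = 2 * 2)
        (complexBetti.map (fst S S) (2 * 1) (η.symm (V i)))
        (complexBetti.map (snd S S) (2 * 1) (η.symm (V j))), ?_, fun y => ?_⟩
  · exact Submodule.add_mem _ h₁ (Submodule.sum_mem _ fun i _ => Submodule.sum_mem _ fun j _ =>
      Submodule.smul_mem _ _ (hmem i j))
  · rw [← main y]
    exact corrAction_apply μ hSp hSp _ _ y

/-- **Words in reflections are finite-rank perturbations of the identity spanned by their vectors**: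
for lattice vectors `v₁, …, v_k`, `s_{v₁} ∘ ⋯ ∘ s_{v_k} = id + Σᵢⱼ aᵢⱼ (Vⱼ.–) Vᵢ` on `Λ_ℂ` with every
`Vᵢ` one of the `vₘ` (with repetitions) — induction on the word:
`s_v ∘ (id + Σ aᵢⱼ (Vⱼ.–) Vᵢ) = id + Σ aᵢⱼ (Vⱼ.–) Vᵢ − c (v.–) v − Σᵢⱼ c aᵢⱼ (v.Vᵢ)(Vⱼ.–) v`,
`c = 2/(v.v)`. (Elementary; the reason why compositions of reflective correspondences need no
moving lemma.) [cite: Huybrechts2019, §1.1] [cite: Buskin2019, §6.2] -/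
theorem listProd_k3ReflectionC_eq_id_add_sum (l : List (K3Index → ℤ)) :
    ∃ (n : ℕ) (V : Fin n → K3Index → ℂ) (a : Fin n → Fin n → ℂ),
      (∀ i, ∃ u ∈ l, V i = fun k => (u k : ℂ)) ∧
      ∀ z : K3Index → ℂ, (l.map k3ReflectionC).prod z = z + ∑ i, ∑ j, (a i j * k3Form (V j) z) • V i := by
  induction l with
  | nil => exact ⟨0, Fin.elim0, fun i => i.elim0, fun i => i.elim0, fun z => by simp⟩
  | cons v l ih =>
    obtain ⟨n, V, a, hV, hw⟩ := ih
    obtain ⟨vC, hvC⟩ : ∃ vC : K3Index → ℂ, (fun k => (v k : ℂ)) = vC := ⟨_, rfl⟩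
    obtain ⟨c, hc⟩ : ∃ c : ℂ, 2 / k3Form vC vC = c := ⟨_, rfl⟩
    refine ⟨n + 1, Fin.cons vC V,
      Fin.cons (Fin.cons (-c) fun j => -c * ∑ i, a i j * k3Form vC (V i)) (fun i => Fin.cons 0 (a i)),
      ?_, fun z => ?_⟩
    · refine Fin.cases ⟨v, List.mem_cons_self, ?_⟩ (fun i => ?_)
      · simp [hvC]
      · obtain ⟨u, hu, hVu⟩ := hV i
        exact ⟨u, List.mem_cons_of_mem v hu, by simp [hVu]⟩
    · rw [List.map_cons, List.prod_cons, Module.End.mul_apply, hw z, k3ReflectionC_apply, hvC, hc]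
      simp only [Fin.sum_univ_succ, Fin.cons_zero, Fin.cons_succ, zero_mul, zero_smul, zero_add,
        k3Form_add_right, k3Form_sum_right, k3Form_smul_right]
      have key : ∑ j, (-c * ∑ i, a i j * k3Form vC (V i)) * k3Form (V j) z =
          -(c * ∑ i, ∑ j, a i j * k3Form (V j) z * k3Form vC (V i)) := by
        rw [Finset.sum_comm (f := fun i j => a i j * k3Form (V j) z * k3Form vC (V i)), Finset.mul_sum,
          ← Finset.sum_neg_distrib]
        refine Finset.sum_congr rfl fun j _ => ?_
        rw [Finset.mul_sum, Finset.sum_mul, Finset.mul_sum, ← Finset.sum_neg_distrib]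
        refine Finset.sum_congr rfl fun i _ => ?_
        ring
      rw [← Finset.sum_smul, key, ← add_smul, sub_eq_add_neg, ← neg_smul]
      have hcoef : -c * k3Form vC z + -(c * ∑ i, ∑ j, a i j * k3Form (V j) z * k3Form vC (V i)) =
          -(c * (k3Form vC z + ∑ i, ∑ j, a i j * k3Form (V j) z * k3Form vC (V i))) := by ring
      rw [hcoef]
      abel

end FiniteRank

section FiniteRankTwo

variable {S S' : Motives.SchemeOver ℂ}

/-! ### Finite-rank operators through algebraic classes, two surfaces -/

/-- `Corr[μ, S, S', hS, hS' ; γ, y]` (as in `K3SurfaceProofs`). Local notation only. -/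
local notation3 (prettyPrint := false) "Corr[" μ ", " S ", " S' ", " hS ", " hS' " ; " γ ", " y "]" =>
  HodgeTheory.complexGysin μ
    (Motives.IsSmoothProjective.tensor_holds (IsK3Surface.isSmoothProjective hS)
      (IsK3Surface.isSmoothProjective hS'))
    (IsK3Surface.isSmoothProjective hS) (SemiCartesianMonoidalCategory.fst S S')
    (rfl : 2 * 1 + 2 * 2 + 2 * 2 = 2 * 1 + 2 * (2 + 2))
    (cupProduct (rfl : 2 * 1 + 2 * 2 = 2 * 1 + 2 * 2)
      (HodgeTheory.complexBetti.map (SemiCartesianMonoidalCategory.snd S S') (2 * 1) y) γ)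

/-- **Finite-rank operators through algebraic classes are algebraic correspondences** (two K3
surfaces; Fulton Example 16.1.2 (a): the classes `V × W` span the degenerate correspondences, acting
by `y ↦ (∫ y ∪ W) V`). For K3 surfaces `S`, `S'`, a marking `η'` of `S'` (`a ∪ b = (η'a.η'b) p'`),
algebraic classes `δ₁, …, δ_m ∈ N¹ H²(S(ℂ); ℂ)`, lattice-side vectors `V'₁, …, V'_n ∈ Λ_ℂ` with
`η'⁻¹(V'ⱼ)` algebraic on `S'`, coefficients `aᵢⱼ ∈ ℂ` and every orientation family `μ`, the operator
`y ↦ Σᵢⱼ aᵢⱼ (V'ⱼ.η'y) δᵢ` from `H²(S'(ℂ); ℂ)` to `H²(S(ℂ); ℂ)` is `[γ]_*^μ` with the ALGEBRAIC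
`γ = Σᵢⱼ (aᵢⱼ/d') • (fst^* δᵢ ∪ snd^* η'⁻¹(V'ⱼ)) ∈ N² H⁴((S ⊗ S')(ℂ); ℂ)`, `fst_*(snd^* p') = d' • 1`,
`d' ≠ 0` (`complexGysin_fst_map_snd_ne_zero`). In particular every homomorphism
`H²(S'; ℚ) → H²(S; ℚ)` that kills `T(S')` and lands in `NS(S)_ℚ` ("lies in `NS(S) ⊗ NS(S')`") is an
algebraic correspondence. [cite: Fulton1998, §16.1 Def. 16.1.2, Example 16.1.2 (a) and Remark 16.1 (ii)]
[cite: FultonYoungTableaux1997, Appendix B §B.1 (3), (5) and (6)] -/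
theorem corr_sum_smul_of_mem_algebraicClasses (μ : OrientationFamily) (hS : IsK3Surface S)
    (hS' : IsK3Surface S') (η' : complexBetti S' (2 * 1) ≃ₗ[ℂ] (K3Index → ℂ))
    (p' : complexBetti S' (2 * 2))
    (hcup' : ∀ a b : complexBetti S' (2 * 1),
      cupProduct (rfl : 2 * 1 + 2 * 1 = 2 * 2) a b = k3Form (η' a) (η' b) • p')
    {ι κ : Type} [Fintype ι] [Fintype κ] (δ : ι → complexBetti S (2 * 1))
    (hδ : ∀ i, δ i ∈ algebraicClasses S 1) (V' : κ → K3Index → ℂ)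
    (hV' : ∀ j, η'.symm (V' j) ∈ algebraicClasses S' 1) (a : ι → κ → ℂ) :
    ∃ γ ∈ algebraicClasses (MonoidalCategoryStruct.tensorObj S S') 2,
      ∀ y : complexBetti S' (2 * 1),
        ∑ i, ∑ j, (a i j * k3Form (V' j) (η' y)) • δ i = Corr[μ, S, S', hS, hS' ; γ, y] := by
  have hSp : Motives.IsSmoothProjective 2 S := hS.isSmoothProjective
  have hSp' : Motives.IsSmoothProjective 2 S' := hS'.isSmoothProjective
  have hSS := Motives.IsSmoothProjective.tensor_holds hSp hSp'
  have hp' : p' ≠ 0 := ne_zero_of_cupProduct_eq_k3Form_smul μ hSp' η' p' hcup'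
  obtain ⟨d, hd⟩ := exists_eq_smul_one μ hSp (complexGysin μ hSS hSp (fst S S')
    (rfl : 2 * 2 + 2 * 2 = 0 + 2 * (2 + 2)) (complexBetti.map (snd S S') (2 * 2) p'))
  have hd0 : d ≠ 0 := by
    rintro rfl
    rw [zero_smul] at hd
    exact complexGysin_fst_map_snd_ne_zero μ hSp hSp' hp' hd
  have hγ₂ : ∀ (i : ι) (j : κ) (y : complexBetti S' (2 * 1)),
      corrAction μ hSp hSp' (rfl : 2 * 1 + 2 * 2 = 2 * 1 + 2 * 2)
        (cupProduct (rfl : 2 * 1 + 2 * 1 = 2 * 2) (complexBetti.map (fst S S') (2 * 1) (δ i))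
          (complexBetti.map (snd S S') (2 * 1) (η'.symm (V' j)))) y =
        (k3Form (η' y) (V' j) * d) • δ i := fun i j y => by
    rw [corrAction_cupProduct_map_fst_map_snd₂, hcup' y, η'.apply_symm_apply, map_smul, map_smul, hd,
      smul_smul, map_smul, cupProduct_one]
  have hmem : ∀ (i : ι) (j : κ), cupProduct (rfl : 2 * 1 + 2 * 1 = 2 * 2)
      (complexBetti.map (fst S S') (2 * 1) (δ i))
      (complexBetti.map (snd S S') (2 * 1) (η'.symm (V' j))) ∈
        algebraicClasses (MonoidalCategoryStruct.tensorObj S S') 2 := fun i j => by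
    have h := cupProduct_map_fst_map_snd_mem_algebraicClasses hSp hSp' (hδ i) (hV' j)
    exact h
  have main : ∀ y : complexBetti S' (2 * 1), corrAction μ hSp hSp' (rfl : 2 * 1 + 2 * 2 = 2 * 1 + 2 * 2)
      (∑ i, ∑ j, (a i j / d) • cupProduct (rfl : 2 * 1 + 2 * 1 = 2 * 2)
          (complexBetti.map (fst S S') (2 * 1) (δ i))
          (complexBetti.map (snd S S') (2 * 1) (η'.symm (V' j)))) y =
      ∑ i, ∑ j, (a i j * k3Form (V' j) (η' y)) • δ i := fun y => by
    simp only [map_sum, map_smul, LinearMap.sum_apply, LinearMap.smul_apply, hγ₂, smul_smul]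
    refine Finset.sum_congr rfl fun i _ => Finset.sum_congr rfl fun j _ => ?_
    rw [k3Form_comm (η' y) (V' j)]
    congr 1
    field_simp
  refine ⟨∑ i, ∑ j, (a i j / d) • cupProduct (rfl : 2 * 1 + 2 * 1 = 2 * 2)
      (complexBetti.map (fst S S') (2 * 1) (δ i))
      (complexBetti.map (snd S S') (2 * 1) (η'.symm (V' j))), ?_, fun y => ?_⟩
  · exact Submodule.sum_mem _ fun i _ => Submodule.sum_mem _ fun j _ =>
      Submodule.smul_mem _ _ (hmem i j)
  · rw [← main y]
    exact corrAction_apply μ hSp hSp' _ _ y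

/-- **Algebraic correspondences are stable under finite-rank perturbations through algebraic
classes**: if `ψ = [γ₀]_*^μ` with `γ₀` algebraic, then so is `y ↦ ψ y + Σᵢⱼ aᵢⱼ (V'ⱼ.η'y) δᵢ`
(`corr_sum_smul_of_mem_algebraicClasses` and linearity of `γ ↦ [γ]_*`). This is the shape in which
"differs from an algebraic correspondence by a class in `NS(S) ⊗ NS(S')`" arguments are consumed.
[cite: Fulton1998, §16.1 Example 16.1.2 (a) and Remark 16.1 (ii)] -/
theorem corr_add_sum_smul_of_mem_algebraicClasses (μ : OrientationFamily) (hS : IsK3Surface S)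
    (hS' : IsK3Surface S') (η' : complexBetti S' (2 * 1) ≃ₗ[ℂ] (K3Index → ℂ))
    (p' : complexBetti S' (2 * 2))
    (hcup' : ∀ a b : complexBetti S' (2 * 1),
      cupProduct (rfl : 2 * 1 + 2 * 1 = 2 * 2) a b = k3Form (η' a) (η' b) • p')
    {ι κ : Type} [Fintype ι] [Fintype κ] (δ : ι → complexBetti S (2 * 1))
    (hδ : ∀ i, δ i ∈ algebraicClasses S 1) (V' : κ → K3Index → ℂ)
    (hV' : ∀ j, η'.symm (V' j) ∈ algebraicClasses S' 1) (a : ι → κ → ℂ)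
    (ψ : complexBetti S' (2 * 1) → complexBetti S (2 * 1)) {γ₀ : complexBetti (S ⊗ S') (2 * 2)}
    (hγ₀ : γ₀ ∈ algebraicClasses (MonoidalCategoryStruct.tensorObj S S') 2)
    (hψ : ∀ y : complexBetti S' (2 * 1), ψ y = Corr[μ, S, S', hS, hS' ; γ₀, y]) :
    ∃ γ ∈ algebraicClasses (MonoidalCategoryStruct.tensorObj S S') 2,
      ∀ y : complexBetti S' (2 * 1),
        ψ y + ∑ i, ∑ j, (a i j * k3Form (V' j) (η' y)) • δ i = Corr[μ, S, S', hS, hS' ; γ, y] := by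
  obtain ⟨γ₁, hγ₁, h₁⟩ := corr_sum_smul_of_mem_algebraicClasses μ hS hS' η' p' hcup' δ hδ V' hV' a
  refine ⟨γ₀ + γ₁, Submodule.add_mem _ hγ₀ hγ₁, fun y => ?_⟩
  rw [hψ y, h₁ y, map_add, map_add]

end FiniteRankTwo

section GraphOfMorphism

variable {μ : OrientationFamily} {S S' : Motives.SchemeOver ℂ}

/-! ### Graphs of morphisms between two K3 surfaces are algebraic correspondences -/

/-- **Push–pull for a graph class with two targets** `[(f, g)₊ 1]_* = f₊ ∘ g^*` for `f : T ⟶ X`,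
`g : T ⟶ X'` (smooth projective, dimensions `d`, `n`, `n'`, `d + e = n + n'`), the class
`(f, g)₊ 1 ∈ H^{2e}((X ⊗ X')(ℂ); ℂ)` acting from `Hᵃ(X'(ℂ))` to `Hᵇ(X(ℂ))` through `corrAction μ`
(Fulton §16.1: the correspondence `(f, g)_*[T]` acts by `f_* g^*`; for `T = X`, `f = 𝟙` this is
Prop. 16.1.2 (c), "`(Γ_g)^* = g^*`"). Same proof as `HodgeTheory.corrAction_gysinGraph_one`
(the case `X' = X`): projection formula for `lift f g`, `∪ 1 = id`, `(f, g) ≫ pr₂ = g`,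
`(f, g) ≫ pr₁ = f`. [cite: Fulton1998, §16.1 Def. 16.1.2 and Prop. 16.1.2 (c)]
[cite: FultonYoungTableaux1997, Appendix B §B.1 (5)–(6)] -/
theorem corrAction_gysinLift_one (hμ : μ.HasPoincareDuality) {d n n' : ℕ}
    {T X X' : Motives.SchemeOver ℂ} (hT : Motives.IsSmoothProjective d T)
    (hX : Motives.IsSmoothProjective n X) (hX' : Motives.IsSmoothProjective n' X')
    (f : T ⟶ X) (g : T ⟶ X') {e a b : ℕ} (hde : d + e = n + n') (hab : a + 2 * e = b + 2 * n') :
    corrAction μ hX hX' hab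
        (complexGysin μ hT (Motives.IsSmoothProjective.tensor_holds hX hX') (lift f g)
          (show 0 + 2 * (n + n') = 2 * e + 2 * d by omega)
          (singularCohomology.one ℂ (Motives.ComplexPoints T))) =
      complexGysin μ hT hX f (show a + 2 * n = b + 2 * d by omega) ∘ₗ (complexBetti.map g a).hom := by
  have hXX := Motives.IsSmoothProjective.tensor_holds hX hX'
  refine LinearMap.ext fun β => ?_
  rw [corrAction_apply, LinearMap.comp_apply,
    ← complexGysin_cup hμ hT hXX (lift f g) (Nat.add_zero a)
      (show a + 2 * (n + n') = a + 2 * e + 2 * d by omega)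
      (show 0 + 2 * (n + n') = 2 * e + 2 * d by omega) rfl
      (complexBetti.map (snd X X') a β) (singularCohomology.one ℂ (Motives.ComplexPoints T)),
    cupProduct_one, ← CategoryTheory.comp_apply, ← complexBetti.map_comp, lift_snd,
    ← LinearMap.comp_apply (f := complexGysin μ hXX hX (fst X X') _),
    ← complexGysin_comp hμ hT hXX hX (lift f g) (fst X X')]
  simp only [lift_fst]

/-- **Graph classes with two targets are algebraic**: `(f, g)₊ 1 ∈ Nᵉ H^{2e}((X ⊗ X')(ℂ); ℂ)` for
`f : T ⟶ X`, `g : T ⟶ X'`, `d + e = n + n'` (proper push-forward shifts the coniveau by the relative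
dimension, `complexGysin_mem_supportedClasses` with `gysinMap_restrictCompl_eq_zero_of_field ℂ`, and
`1 ∈ N⁰ H⁰`). [cite: FultonYoungTableaux1997, Appendix B §B.2 Exercise 5 and §B.3] -/
theorem gysinLift_one_mem_algebraicClasses (μ : OrientationFamily) (hμ : μ.HasPoincareDuality)
    {d n n' : ℕ} {T X X' : Motives.SchemeOver ℂ} (hT : Motives.IsSmoothProjective d T)
    (hX : Motives.IsSmoothProjective n X) (hX' : Motives.IsSmoothProjective n' X') (f : T ⟶ X)
    (g : T ⟶ X') {e : ℕ} (hde : d + e = n + n') :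
    complexGysin μ hT (Motives.IsSmoothProjective.tensor_holds hX hX') (lift f g)
        (show 0 + 2 * (n + n') = 2 * e + 2 * d by omega)
        (singularCohomology.one ℂ (Motives.ComplexPoints T)) ∈ algebraicClasses (X ⊗ X') e :=
  complexGysin_mem_supportedClasses (gysinMap_restrictCompl_eq_zero_of_field ℂ) μ hμ hT
    (Motives.IsSmoothProjective.tensor_holds hX hX') (lift f g) _ (r := 0) (by omega)
    (by rw [supportedClasses_zero]; exact Submodule.mem_top)

/-- `Corr[μ, S, S', hS, hS' ; γ, y] = [γ]_* y = fst_* (snd^* y ∪ γ)` (as in `K3SurfaceProofs`):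
LITERALLY the expression in the conclusion of `Buskin2019_reflectiveHodgeIsometry_algebraic`. Local
notation only. -/
local notation3 (prettyPrint := false) "Corr[" μ ", " S ", " S' ", " hS ", " hS' " ; " γ ", " y "]" =>
  HodgeTheory.complexGysin μ
    (Motives.IsSmoothProjective.tensor_holds (IsK3Surface.isSmoothProjective hS)
      (IsK3Surface.isSmoothProjective hS'))
    (IsK3Surface.isSmoothProjective hS) (SemiCartesianMonoidalCategory.fst S S')
    (rfl : 2 * 1 + 2 * 2 + 2 * 2 = 2 * 1 + 2 * (2 + 2))
    (cupProduct (rfl : 2 * 1 + 2 * 2 = 2 * 1 + 2 * 2)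
      (HodgeTheory.complexBetti.map (SemiCartesianMonoidalCategory.snd S S') (2 * 1) y) γ)

/-- **Pull-back along a morphism of K3 surfaces is an algebraic correspondence** (the transposed
graph: Fulton Prop. 16.1.2 (c), "`(Γ_f)^* = f^*`"; in Buskin's introduction, for an
isomorphism `f : S₂ → S₁`, "the cycle `Z_φ`, cohomologous to the graph `Γ_f` of the map `f`, is
algebraic", and in Huybrechts 2019's introduction "`[φ] = [Γ_f]`, which is algebraic"). For K3 surfaces `S`, `S'`, a morphism `g : S ⟶ S'` and every
orientation family `μ`: `g^* = [γ]_*^μ` on `H²(S'(ℂ); ℂ)` with the algebraic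
`γ = (𝟙, g)₊ 1 ∈ N² H⁴((S ⊗ S')(ℂ); ℂ)` (`corrAction_gysinLift_one` with `(𝟙 S)₊ = id`).
[cite: Fulton1998, §16.1 Prop. 16.1.2 (c)] [cite: Buskin2019, §1 (Introduction)] [cite: Huybrechts2019, Introduction] -/
theorem corr_map_of_hom (μ : OrientationFamily) (hS : IsK3Surface S) (hS' : IsK3Surface S')
    (g : S ⟶ S') :
    ∃ γ ∈ algebraicClasses (MonoidalCategoryStruct.tensorObj S S') 2,
      ∀ y : complexBetti S' (2 * 1), complexBetti.map g (2 * 1) y = Corr[μ, S, S', hS, hS' ; γ, y] := by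
  have hμ : μ.HasPoincareDuality := OrientationFamily.hasPoincareDuality μ
  have hSp : Motives.IsSmoothProjective 2 S := hS.isSmoothProjective
  have hSp' : Motives.IsSmoothProjective 2 S' := hS'.isSmoothProjective
  refine ⟨complexGysin μ hSp (Motives.IsSmoothProjective.tensor_holds hSp hSp') (lift (𝟙 S) g)
      (show 0 + 2 * (2 + 2) = 2 * 2 + 2 * 2 from rfl) (singularCohomology.one ℂ (Motives.ComplexPoints S)),
    gysinLift_one_mem_algebraicClasses μ hμ hSp hSp hSp' (𝟙 S) g (e := 2) rfl, fun y => ?_⟩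
  have h := LinearMap.congr_fun
    (corrAction_gysinLift_one hμ hSp hSp hSp' (𝟙 S) g (e := 2) (a := 2 * 1) (b := 2 * 1) rfl rfl) y
  rw [LinearMap.comp_apply, complexGysin_id hμ hSp, LinearMap.id_apply] at h
  exact h.symm.trans (corrAction_apply μ hSp hSp' _ _ y)

/-- **Lattice isometries induced by morphisms via markings are algebraic** (marked form of
`corr_map_of_hom`, the shape of the leaf's conclusion): if `g : S ⟶ S'` intertwines the markings
`η`, `η'` through a lattice operator `σ`, `η (g^* y) = σ (η' y)`, then `η⁻¹ ∘ σ ∘ η' = g^*` is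
`[γ]_*^μ` for an algebraic `γ ∈ N² H⁴((S ⊗ S')(ℂ); ℂ)` — the Torelli case of Shafarevich's
question ("there exists a unique isomorphism `f : S₂ → S₁` inducing `φ`. So, in particular, the
cycle `Z_φ` … is algebraic"). [cite: Buskin2019, §1 (Introduction)] [cite: Fulton1998, §16.1 Prop. 16.1.2 (c)] -/
theorem corr_marking_of_hom (μ : OrientationFamily) (hS : IsK3Surface S) (hS' : IsK3Surface S')
    (η : complexBetti S (2 * 1) ≃ₗ[ℂ] (K3Index → ℂ))
    (η' : complexBetti S' (2 * 1) ≃ₗ[ℂ] (K3Index → ℂ)) (g : S ⟶ S')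
    (σ : Module.End ℂ (K3Index → ℂ))
    (hσ : ∀ y : complexBetti S' (2 * 1), η (complexBetti.map g (2 * 1) y) = σ (η' y)) :
    ∃ γ ∈ algebraicClasses (MonoidalCategoryStruct.tensorObj S S') 2,
      ∀ y : complexBetti S' (2 * 1), η.symm (σ (η' y)) = Corr[μ, S, S', hS, hS' ; γ, y] := by
  obtain ⟨γ, hγ, h⟩ := corr_map_of_hom μ hS hS' g
  refine ⟨γ, hγ, fun y => ?_⟩
  rw [← hσ, LinearEquiv.symm_apply_apply]
  exact h y

end GraphOfMorphism

section IsoCase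

variable {S S' : Motives.SchemeOver ℂ}

/-! ### Transport along isomorphisms: the leaf for pairs isomorphic as marked surfaces -/

/-- `MarkedK3[S, η, p, x]` (as in `K3SurfaceProofs` / `K3SurfaceBuskinLeaves`): a marked K3 surface
with period `x`. Local notation only. -/
local notation3 (prettyPrint := false) "MarkedK3[" S ", " η ", " p ", " x "]" =>
  (HodgeTheory.IsIntegralClass p ∧
    (∀ q : HodgeTheory.complexBetti S (2 * 2), HodgeTheory.IsIntegralClass q → ∃ n : ℤ, q = n • p) ∧
    (∀ c : HodgeTheory.complexBetti S (2 * 1),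
        HodgeTheory.IsIntegralClass c ↔ ∃ v : K3Index → ℤ, η c = fun i => (v i : ℂ)) ∧
    (∀ a b : HodgeTheory.complexBetti S (2 * 1),
        cupProduct (rfl : 2 * 1 + 2 * 1 = 2 * 2) a b = k3Form (η a) (η b) • p) ∧
    HodgeTheory.IsOfHodgeType 2 S (2 * 1) 2 0 (LinearEquiv.symm η x) ∧
    (∀ τ : HodgeTheory.complexBetti S (2 * 1),
        HodgeTheory.IsOfHodgeType 2 S (2 * 1) 2 0 τ → ∃ t : ℂ, τ = t • LinearEquiv.symm η x))

/-- `PeriodPt[x]` (as in `K3SurfaceProofs`): a projective period point. Local notation only. -/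
local notation3 (prettyPrint := false) "PeriodPt[" x "]" =>
  (k3Form x x = 0 ∧ 0 < (k3Form (star x) x).re ∧
    ∃ u : K3Index → ℤ, k3Form (fun i => (u i : ℂ)) x = 0 ∧ 0 < ∑ i, ∑ j, u i * k3Gram i j * u j)

/-- `Corr[μ, S, S', hS, hS' ; γ, y] = [γ]_* y = fst_* (snd^* y ∪ γ)` (as in `K3SurfaceProofs`):
LITERALLY the expression in the conclusion of `Buskin2019_reflectiveHodgeIsometry_algebraic`. Local
notation only. -/
local notation3 (prettyPrint := false) "Corr[" μ ", " S ", " S' ", " hS ", " hS' " ; " γ ", " y "]" =>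
  HodgeTheory.complexGysin μ
    (Motives.IsSmoothProjective.tensor_holds (IsK3Surface.isSmoothProjective hS)
      (IsK3Surface.isSmoothProjective hS'))
    (IsK3Surface.isSmoothProjective hS) (SemiCartesianMonoidalCategory.fst S S')
    (rfl : 2 * 1 + 2 * 2 + 2 * 2 = 2 * 1 + 2 * (2 + 2))
    (cupProduct (rfl : 2 * 1 + 2 * 2 = 2 * 1 + 2 * 2)
      (HodgeTheory.complexBetti.map (SemiCartesianMonoidalCategory.snd S S') (2 * 1) y) γ)


/-- **`1 ≠ 0` in `H⁰(T(ℂ); ℂ)`** for `T` smooth projective (of dimension `n`): `1 ⌢ [T(ℂ)]_μ = [T(ℂ)]_μ ≠ 0`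
(`one_capProduct`, `fundamentalClass_ne_zero`; `T(ℂ)` is a non-empty closed manifold).
[cite: HatcherAT2002, §3.3 Thm. 3.26] -/
theorem singularCohomology_one_ne_zero (μ : OrientationFamily) {n : ℕ} {T : Motives.SchemeOver ℂ}
    (hT : Motives.IsSmoothProjective n T) :
    singularCohomology.one ℂ (Motives.ComplexPoints T) ≠ 0 := by
  letI := hT.chartedSpace
  haveI := Motives.ComplexPoints.compactSpace_of_isSmoothProjective hT
  haveI := Motives.ComplexPoints.t2Space_of_isSmoothProjective hT
  haveI := connectedSpace_complexPoints hT
  intro h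
  apply fundamentalClass_ne_zero (μ hT)
  rw [← one_capProduct (μ hT).fundamentalClass, h, map_zero, LinearMap.zero_apply]

/-- **An algebraic self-correspondence of `S` precomposed with the pull-back along an isomorphism
`f : S ≅ S'` is an algebraic correspondence from `S'` to `S`** (Fulton Prop. 16.1.1 (c) (ii), "If
`α = Γ_f`, then `β ∘ α = (f × 1_Z)^*(β)`", in cohomology and for an isomorphism, where no moving
lemma is needed):
for K3 surfaces `S`, `S'`, `f : S ≅ S'`, an algebraic `γ ∈ N² H⁴((S ⊗ S)(ℂ); ℂ)` and every
orientation family `μ`, `[γ]_*^μ (f^* y) = [γ']_*^μ y` for all `y ∈ H²(S'(ℂ); ℂ)` with the algebraic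
`γ' = c⁻¹ • F^* γ`, `F = S ◁ f⁻¹ : S ⊗ S' ⟶ S ⊗ S`: `F` is an isomorphism, hence flat, so `F^* γ` is
algebraic (`map_mem_supportedClasses_of_flat_left`); `snd_{S,S'}^* = F^* ∘ snd^* ∘ f^*`,
`fst_{S,S'} = F ≫ fst` (`whiskerLeft_snd`, `whiskerLeft_fst`), `(fst)_* ∘ F_* ∘ F^* = (fst)_* (– ∪ F_* 1)`
(functoriality and projection formula) and `F_* 1 = c • 1` with `c ≠ 0` (`(S ◁ f)_* F_* 1 = 1 ≠ 0`,
`singularCohomology_one_ne_zero`). [cite: Fulton1998, §16.1 Prop. 16.1.1 (c) (ii) and Prop. 16.1.2 (c)]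
[cite: FultonYoungTableaux1997, Appendix B §B.1 (5)–(6)] [cite: Hartshorne1977, III Prop. 9.5] -/
theorem exists_corr_map_iso (μ : OrientationFamily) (hS : IsK3Surface S) (hS' : IsK3Surface S')
    (f : S ≅ S') {γ : complexBetti (MonoidalCategoryStruct.tensorObj S S) (2 * 2)}
    (hγ : γ ∈ algebraicClasses (MonoidalCategoryStruct.tensorObj S S) 2) :
    ∃ γ' ∈ algebraicClasses (MonoidalCategoryStruct.tensorObj S S') 2, ∀ y : complexBetti S' (2 * 1),
      Corr[μ, S, S, hS, hS ; γ, complexBetti.map f.hom (2 * 1) y] = Corr[μ, S, S', hS, hS' ; γ', y] := by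
  have hμ : μ.HasPoincareDuality := OrientationFamily.hasPoincareDuality μ
  have hSp : Motives.IsSmoothProjective 2 S := hS.isSmoothProjective
  have hSp' : Motives.IsSmoothProjective 2 S' := hS'.isSmoothProjective
  have hSS := Motives.IsSmoothProjective.tensor_holds hSp hSp
  have hSS' := Motives.IsSmoothProjective.tensor_holds hSp hSp'
  -- `F = S ◁ f⁻¹ : S ⊗ S' ⟶ S ⊗ S`, with `F₊ 1 = c • 1`, `c ≠ 0`
  obtain ⟨c, hc⟩ := exists_eq_smul_one μ hSS (complexGysin μ hSS' hSS (S ◁ f.inv)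
    (rfl : 0 + 2 * (2 + 2) = 0 + 2 * (2 + 2)) (singularCohomology.one ℂ (Motives.ComplexPoints (S ⊗ S'))))
  have hc0 : c ≠ 0 := by
    rintro rfl
    rw [zero_smul] at hc
    apply singularCohomology_one_ne_zero μ hSS'
    have h := congrArg (complexGysin μ hSS hSS' (S ◁ f.hom) (rfl : 0 + 2 * (2 + 2) = 0 + 2 * (2 + 2))) hc
    rw [map_zero, ← LinearMap.comp_apply,
      ← complexGysin_comp hμ hSS' hSS hSS' (S ◁ f.inv) (S ◁ f.hom) rfl rfl,
      ← MonoidalCategory.whiskerLeft_comp, f.inv_hom_id, MonoidalCategory.whiskerLeft_id,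
      complexGysin_id hμ hSS', LinearMap.id_apply] at h
    exact h
  -- the class `c⁻¹ • F^* γ`
  haveI : IsIso (S ◁ f.inv).left := show IsIso ((Over.forget _).map (S ◁ f.inv)) from inferInstance
  haveI := Motives.IsSmoothProjective.isLocallyNoetherian_holds hSS
  haveI := Motives.IsSmoothProjective.isLocallyNoetherian_holds hSS'
  have hγ' : complexBetti.map (S ◁ f.inv) (2 * 2) γ ∈
      algebraicClasses (MonoidalCategoryStruct.tensorObj S S') 2 :=
    map_mem_supportedClasses_of_flat_left (S ◁ f.inv) hγ
  refine ⟨c⁻¹ • complexBetti.map (S ◁ f.inv) (2 * 2) γ, Submodule.smul_mem _ _ hγ', fun y => ?_⟩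
  -- `snd'^* y = F^*(snd^*(f^* y))`
  have hsnd : complexBetti.map (snd S S') (2 * 1) y = complexBetti.map (S ◁ f.inv) (2 * 1)
      (complexBetti.map (snd S S) (2 * 1) (complexBetti.map f.hom (2 * 1) y)) := by
    rw [← CategoryTheory.comp_apply, ← complexBetti.map_comp, whiskerLeft_snd,
      ← CategoryTheory.comp_apply, ← complexBetti.map_comp, Category.assoc, f.inv_hom_id,
      Category.comp_id]
  -- `fst' = F ≫ fst`
  have hfst : complexGysin μ hSS' hSp (fst S S') (rfl : 2 * 1 + 2 * 2 + 2 * 2 = 2 * 1 + 2 * (2 + 2)) =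
      complexGysin μ hSS hSp (fst S S) (rfl : 2 * 1 + 2 * 2 + 2 * 2 = 2 * 1 + 2 * (2 + 2)) ∘ₗ
        complexGysin μ hSS' hSS (S ◁ f.inv)
          (rfl : 2 * 1 + 2 * 2 + 2 * (2 + 2) = 2 * 1 + 2 * 2 + 2 * (2 + 2)) := by
    rw [← complexGysin_comp hμ hSS' hSS hSp (S ◁ f.inv) (fst S S)]
    simp only [whiskerLeft_fst]
  change complexGysin μ hSS hSp (fst S S) _ (cupProduct _ (complexBetti.map (snd S S) (2 * 1) _) γ) =
    complexGysin μ hSS' hSp (fst S S') _ (cupProduct _ (complexBetti.map (snd S S') (2 * 1) y) _)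
  rw [hsnd, map_smul, hfst, LinearMap.comp_apply, map_smul, ← complexBetti_map_cupProduct,
    ← cupProduct_one (complexBetti.map (S ◁ f.inv) (2 * 1 + 2 * 2) _),
    complexGysin_cup hμ hSS' hSS (S ◁ f.inv) (Nat.add_zero _) _
      (rfl : 0 + 2 * (2 + 2) = 0 + 2 * (2 + 2)) (Nat.add_zero _), hc, map_smul, map_smul,
    cupProduct_one, map_smul, smul_smul, inv_mul_cancel₀ hc0, one_smul]

/-- **Buskin's Prop. 6.2 for reflective isometries, for marked pairs isomorphic as marked surfaces**
— the named fact `Buskin2019_reflectiveHodgeIsometry_algebraic` for `(S, η, p, x)`, `(S', η', p', x')`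
in the presence of an isomorphism `f : S ≅ S'` intertwining the markings (`η ∘ f^* = η'`; by the
global Torelli theorem for marked K3 surfaces — not in the tree — this is, up to sign and Weyl
reflections, the case `(v.x') = 0` of the leaf, where `S` and `S'` have the same period), GRANTED the
existing named facts `Huybrechts_K3_hodgeTypes_H2` and `HodgeTheory.lefschetzOneOne_rational`:
pull-back along `f` preserves the type `(2,0)` (`IsOfHodgeType.map_of_le`, a K3 surface having a
Hodge model), so `f^* η'⁻¹(x') = s • η⁻¹(x)`, i.e. `x' = s x` with `s ≠ 0` (`x' ≠ 0` for a period
point); then `s_v(x') ∈ ℂ x` gives `s_v(x) ∈ ℂ x`, the self case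
(`Buskin2019_reflectiveHodgeIsometry_algebraic_self`) yields an algebraic `γ₀` on `S ⊗ S` with
`η⁻¹ ∘ s_v ∘ η = [γ₀]_*`, and `η⁻¹ ∘ s_v ∘ η' = [γ₀]_* ∘ f^* = [γ]_*` with `γ` algebraic on
`S ⊗ S'` (`exists_corr_map_iso`). [cite: Buskin2019, §1 (Introduction: the Torelli case) and §6.2 Prop. 6.2]
[cite: Huybrechts2019, §1.1 Thm. 1.1] [cite: Huybrechts2016K3, Ch. 6 Prop. 1.2 and Example 1.3 (i)]
[cite: VoisinHodgeI2002, §7.3.2 and Thm. 11.30] -/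
theorem Buskin2019_reflectiveHodgeIsometry_algebraic_of_iso
    (hH : Huybrechts_K3_hodgeTypes_H2) (hL11 : lefschetzOneOne_rational)
    (μ : OrientationFamily) (S S' : Motives.SchemeOver ℂ) (hS : IsK3Surface S) (hS' : IsK3Surface S')
    (η : complexBetti S (2 * 1) ≃ₗ[ℂ] (K3Index → ℂ)) (p : complexBetti S (2 * 2)) (x : K3Index → ℂ)
    (η' : complexBetti S' (2 * 1) ≃ₗ[ℂ] (K3Index → ℂ)) (p' : complexBetti S' (2 * 2))
    (x' : K3Index → ℂ) (f : S ≅ S')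
    (hf : ∀ y : complexBetti S' (2 * 1), η (complexBetti.map f.hom (2 * 1) y) = η' y) :
    MarkedK3[S, η, p, x] → PeriodPt[x] → MarkedK3[S', η', p', x'] → PeriodPt[x'] →
    ∀ v : K3Index → ℤ, ∑ i, ∑ j, v i * k3Gram i j * v j ≠ 0 →
    (∃ t : ℂ, k3ReflectionC v x' = t • x) →
    ∃ γ ∈ algebraicClasses (MonoidalCategoryStruct.tensorObj S S') 2,
      ∀ y : complexBetti S' (2 * 1),
        η.symm (k3ReflectionC v (η' y)) = Corr[μ, S, S', hS, hS' ; γ, y] := by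
  intro hm hx hm' hx' v hv ht
  obtain ⟨t, ht⟩ := ht
  -- the period of `S'` pulls back to a multiple `s • σ` of the period of `S`, so `x' = s • x`
  obtain ⟨B, -⟩ := hS.2.2
  have h20 : IsOfHodgeType 2 S (2 * 1) 2 0 (complexBetti.map f.hom (2 * 1) (η'.symm x')) :=
    hm'.2.2.2.2.1.map_of_le hS.isSmoothProjective hS'.isSmoothProjective B f.hom le_rfl
  obtain ⟨s, hs⟩ := hm.2.2.2.2.2 _ h20
  have hx's : x' = s • x := by
    have h := hf (η'.symm x')
    rw [η'.apply_symm_apply, hs, map_smul, LinearEquiv.apply_symm_apply] at h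
    exact h.symm
  have hs0 : s ≠ 0 := by
    rintro rfl
    rw [zero_smul] at hx's
    have h := hx'.2.1
    rw [hx's, k3Form_zero_right, Complex.zero_re] at h
    exact lt_irrefl _ h
  -- hence `s_v x ∈ ℂ x`: the self case applies on `S`
  have htx : ∃ t' : ℂ, k3ReflectionC v x = t' • x := by
    refine ⟨s⁻¹ * t, ?_⟩
    rw [hx's, map_smul] at ht
    rw [← smul_smul, ← ht, smul_smul, inv_mul_cancel₀ hs0, one_smul]
  obtain ⟨γ₀, hγ₀, h₀⟩ :=
    Buskin2019_reflectiveHodgeIsometry_algebraic_self hH hL11 μ S hS η p x hm hx v hv htx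
  obtain ⟨γ, hγ, h⟩ := exists_corr_map_iso μ hS hS' f hγ₀
  refine ⟨γ, hγ, fun y => ?_⟩
  rw [← hf, h₀]
  exact h y

end IsoCase

section TorelliCase

variable {S S' : Motives.SchemeOver ℂ}

/-! ### The Torelli situation: compositions of reflections in classes orthogonal to the period -/

/-- `MarkedK3[S, η, p, x]` (as in `K3SurfaceProofs` / `K3SurfaceBuskinLeaves`): a marked K3 surface
with period `x`. Local notation only. -/
local notation3 (prettyPrint := false) "MarkedK3[" S ", " η ", " p ", " x "]" =>
  (HodgeTheory.IsIntegralClass p ∧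
    (∀ q : HodgeTheory.complexBetti S (2 * 2), HodgeTheory.IsIntegralClass q → ∃ n : ℤ, q = n • p) ∧
    (∀ c : HodgeTheory.complexBetti S (2 * 1),
        HodgeTheory.IsIntegralClass c ↔ ∃ v : K3Index → ℤ, η c = fun i => (v i : ℂ)) ∧
    (∀ a b : HodgeTheory.complexBetti S (2 * 1),
        cupProduct (rfl : 2 * 1 + 2 * 1 = 2 * 2) a b = k3Form (η a) (η b) • p) ∧
    HodgeTheory.IsOfHodgeType 2 S (2 * 1) 2 0 (LinearEquiv.symm η x) ∧
    (∀ τ : HodgeTheory.complexBetti S (2 * 1),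
        HodgeTheory.IsOfHodgeType 2 S (2 * 1) 2 0 τ → ∃ t : ℂ, τ = t • LinearEquiv.symm η x))

/-- `PeriodPt[x]` (as in `K3SurfaceProofs`): a projective period point. Local notation only. -/
local notation3 (prettyPrint := false) "PeriodPt[" x "]" =>
  (k3Form x x = 0 ∧ 0 < (k3Form (star x) x).re ∧
    ∃ u : K3Index → ℤ, k3Form (fun i => (u i : ℂ)) x = 0 ∧ 0 < ∑ i, ∑ j, u i * k3Gram i j * u j)

/-- `Corr[μ, S, S', hS, hS' ; γ, y] = [γ]_* y = fst_* (snd^* y ∪ γ)` (as in `K3SurfaceProofs`):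
LITERALLY the expression in the conclusion of `Buskin2019_reflectiveHodgeIsometry_algebraic`. Local
notation only. -/
local notation3 (prettyPrint := false) "Corr[" μ ", " S ", " S' ", " hS ", " hS' " ; " γ ", " y "]" =>
  HodgeTheory.complexGysin μ
    (Motives.IsSmoothProjective.tensor_holds (IsK3Surface.isSmoothProjective hS)
      (IsK3Surface.isSmoothProjective hS'))
    (IsK3Surface.isSmoothProjective hS) (SemiCartesianMonoidalCategory.fst S S')
    (rfl : 2 * 1 + 2 * 2 + 2 * 2 = 2 * 1 + 2 * (2 + 2))
    (cupProduct (rfl : 2 * 1 + 2 * 2 = 2 * 1 + 2 * 2)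
      (HodgeTheory.complexBetti.map (SemiCartesianMonoidalCategory.snd S S') (2 * 1) y) γ)


/-- **Lattice classes orthogonal to the period are algebraic** (the `(1,1)`-part of the argument of
`Buskin2019_reflectiveHodgeIsometry_algebraic_self`, isolated): for a K3 surface `S` with a marking
`η` (integral classes `↔ Λ`, cup product `=` K3 form `× p`) whose `η⁻¹(x) ≠ 0` is of type `(2,0)`,
and a lattice vector `u` with `(u.x) = 0`, the integral class `η⁻¹(u)` cups to zero with
`σ = η⁻¹(x)` and with `σ̄ = η⁻¹(x̄)` (markings are real, `conjClass_markingSymm`), hence is of type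
`(1,1)` (GRANTED `Huybrechts_K3_hodgeTypes_H2`) and algebraic (GRANTED `lefschetzOneOne_rational`,
integral classes being rational) — "`NS(X) = H^{1,1}(X) ∩ H²(X, ℤ)`", Lefschetz `(1,1)`.
[cite: Huybrechts2016K3, Ch. 6 Prop. 1.2 and Example 1.3 (i); Ch. 1 Prop. 3.5]
[cite: VoisinHodgeI2002, Thm. 11.30] -/
theorem markingSymm_mem_algebraicClasses_of_k3Form_eq_zero
    (hH : Huybrechts_K3_hodgeTypes_H2) (hL11 : lefschetzOneOne_rational) (hS : IsK3Surface S)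
    (η : complexBetti S (2 * 1) ≃ₗ[ℂ] (K3Index → ℂ)) (p : complexBetti S (2 * 2)) {x : K3Index → ℂ}
    (hint : ∀ c : complexBetti S (2 * 1), IsIntegralClass c ↔ ∃ v : K3Index → ℤ, η c = fun i => (v i : ℂ))
    (hcup : ∀ a b : complexBetti S (2 * 1),
      cupProduct (rfl : 2 * 1 + 2 * 1 = 2 * 2) a b = k3Form (η a) (η b) • p)
    (hσ : IsOfHodgeType 2 S (2 * 1) 2 0 (η.symm x)) (hx0 : x ≠ 0)
    {u : K3Index → ℤ} (hu : k3Form (fun i => (u i : ℂ)) x = 0) :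
    η.symm (fun i => (u i : ℂ)) ∈ algebraicClasses S 1 := by
  have hδint : IsIntegralClass (η.symm fun i => (u i : ℂ)) := (hint _).2 ⟨u, η.apply_symm_apply _⟩
  have hσ0 : η.symm x ≠ 0 := fun h => hx0 (by simpa using congrArg η h)
  have h1 : cupProduct (rfl : 2 * 1 + 2 * 1 = 2 * 2) (η.symm fun i => (u i : ℂ)) (η.symm x) = 0 := by
    rw [hcup, η.apply_symm_apply, η.apply_symm_apply, hu, zero_smul]
  have h2 : cupProduct (rfl : 2 * 1 + 2 * 1 = 2 * 2) (η.symm fun i => (u i : ℂ))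
      (conjClass (Motives.ComplexPoints S) (2 * 1) (η.symm x)) = 0 := by
    have hreal : star (fun i => (u i : ℂ)) = fun i => (u i : ℂ) := by
      funext i; simp only [Pi.star_apply, star_intCast]
    rw [conjClass_markingSymm η hint, hcup, η.apply_symm_apply, η.apply_symm_apply, ← hreal,
      ← star_k3Form, hu, star_zero, zero_smul]
  exact hL11 hS.isSmoothProjective _ hδint.isRationalClass (((hH S hS _ hσ hσ0).2.2 _).2 ⟨h1, h2⟩)

/-- `s_0 = id` on `Λ_ℂ` (the total reflection along the zero vector is the identity, `2/0 = 0`).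
[cite: Huybrechts2019, §1.1] -/
theorem k3ReflectionC_zero_apply (z : K3Index → ℂ) : k3ReflectionC 0 z = z := by
  have h0 : (fun i => ((0 : K3Index → ℤ) i : ℂ)) = 0 := by funext i; simp
  rw [k3ReflectionC_apply, h0, smul_zero, sub_zero]

/-- **Products of reflections along algebraic lattice classes are algebraic self-correspondences**
(Buskin §6.2: each reflective step is algebraic and so are compositions — here WITHOUT Lemma 6.3 /
the moving lemma: a word in reflections is a finite-rank perturbation of the identity spanned by its
vectors, `listProd_k3ReflectionC_eq_id_add_sum`, and such perturbations by algebraic classes are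
algebraic self-correspondences, `corr_id_add_sum_of_mem_algebraicClasses`): for a marked K3 surface
`(S, η)` and lattice vectors `u₁, …, u_k` whose classes `η⁻¹(uᵢ)` are algebraic,
`η⁻¹ ∘ (s_{u₁} ∘ ⋯ ∘ s_{u_k}) ∘ η = [γ]_*^μ` with `γ ∈ N² H⁴((S ⊗ S)(ℂ); ℂ)` algebraic.
[cite: Buskin2019, §6.2 proof of Thm. 1.1] [cite: Fulton1998, §16.1 Cor. 16.1.1 and Example 16.1.2 (a)] -/
theorem corr_prod_k3ReflectionC_of_mem_algebraicClasses (μ : OrientationFamily)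
    (hS : IsK3Surface S) (η : complexBetti S (2 * 1) ≃ₗ[ℂ] (K3Index → ℂ)) (p : complexBetti S (2 * 2))
    (hcup : ∀ a b : complexBetti S (2 * 1),
      cupProduct (rfl : 2 * 1 + 2 * 1 = 2 * 2) a b = k3Form (η a) (η b) • p)
    (l : List (K3Index → ℤ)) (hl : ∀ u ∈ l, η.symm (fun i => (u i : ℂ)) ∈ algebraicClasses S 1) :
    ∃ γ ∈ algebraicClasses (MonoidalCategoryStruct.tensorObj S S) 2,
      ∀ y : complexBetti S (2 * 1),
        η.symm ((l.map k3ReflectionC).prod (η y)) = Corr[μ, S, S, hS, hS ; γ, y] := by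
  obtain ⟨n, V, a, hV, hw⟩ := listProd_k3ReflectionC_eq_id_add_sum l
  have halg : ∀ i, η.symm (V i) ∈ algebraicClasses S 1 := fun i => by
    obtain ⟨u, hu, hVu⟩ := hV i
    rw [hVu]
    exact hl u hu
  obtain ⟨γ, hγ, h⟩ := corr_id_add_sum_of_mem_algebraicClasses μ hS η p hcup V halg a
  refine ⟨γ, hγ, fun y => ?_⟩
  rw [hw, map_add, LinearEquiv.symm_apply_apply, ← h y]
  simp only [map_sum, map_smul]

/-- **Core of the Torelli situation**: for a marked K3 surface `(S, η, p, x)` (`η⁻¹(x) ≠ 0` of type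
`(2,0)`), an isomorphism `f : S ≅ S'`, a scalar `ε` and lattice vectors `u₁, …, u_k` orthogonal to
`x`, the operator `y ↦ ε · η⁻¹(s_{u₁} ⋯ s_{u_k}(η(f^* y)))` from `H²(S'(ℂ); ℂ)` to `H²(S(ℂ); ℂ)` is
`[γ]_*^μ` for an algebraic `γ ∈ N² H⁴((S ⊗ S')(ℂ); ℂ)`: the `η⁻¹(uᵢ)` are algebraic
(`markingSymm_mem_algebraicClasses_of_k3Form_eq_zero`), the word acts through an algebraic
self-correspondence of `S` (`corr_prod_k3ReflectionC_of_mem_algebraicClasses`), which transports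
along `f` (`exists_corr_map_iso`) and scales. GRANTED `Huybrechts_K3_hodgeTypes_H2` and
`lefschetzOneOne_rational` (no moving lemma: `corr_prod_k3ReflectionC_of_mem_algebraicClasses`). [cite: Buskin2019, §1 (Introduction) and §6.2] [cite: Huybrechts2016K3, Ch. 8 Cor. 2.9 (Weyl group) and Ch. 7 Thm. 5.3] -/
theorem corr_smul_prod_k3ReflectionC_map_iso
    (hH : Huybrechts_K3_hodgeTypes_H2) (hL11 : lefschetzOneOne_rational)
    (μ : OrientationFamily) (hS : IsK3Surface S) (hS' : IsK3Surface S')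
    (η : complexBetti S (2 * 1) ≃ₗ[ℂ] (K3Index → ℂ)) (p : complexBetti S (2 * 2)) {x : K3Index → ℂ}
    (hint : ∀ c : complexBetti S (2 * 1), IsIntegralClass c ↔ ∃ v : K3Index → ℤ, η c = fun i => (v i : ℂ))
    (hcup : ∀ a b : complexBetti S (2 * 1),
      cupProduct (rfl : 2 * 1 + 2 * 1 = 2 * 2) a b = k3Form (η a) (η b) • p)
    (hσ : IsOfHodgeType 2 S (2 * 1) 2 0 (η.symm x)) (hx0 : x ≠ 0) (f : S ≅ S') (ε : ℂ)
    (l : List (K3Index → ℤ)) (hl : ∀ u ∈ l, k3Form (fun i => (u i : ℂ)) x = 0) :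
    ∃ γ ∈ algebraicClasses (MonoidalCategoryStruct.tensorObj S S') 2,
      ∀ y : complexBetti S' (2 * 1),
        ε • η.symm ((l.map k3ReflectionC).prod (η (complexBetti.map f.hom (2 * 1) y))) =
          Corr[μ, S, S', hS, hS' ; γ, y] := by
  obtain ⟨γ₀, hγ₀, h₀⟩ := corr_prod_k3ReflectionC_of_mem_algebraicClasses μ hS η p hcup l
    fun u hu => markingSymm_mem_algebraicClasses_of_k3Form_eq_zero hH hL11 hS η p hint hcup hσ hx0 (hl u hu)
  obtain ⟨γ₁, hγ₁, h₁⟩ := exists_corr_map_iso μ hS hS' f hγ₀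
  refine ⟨ε • γ₁, Submodule.smul_mem _ _ hγ₁, fun y => ?_⟩
  rw [h₀, h₁ y, map_smul, map_smul]

/-- **Buskin's Prop. 6.2 for reflective isometries, in the Torelli situation** — the named fact
`Buskin2019_reflectiveHodgeIsometry_algebraic` for marked pairs `(S, η, p, x)`, `(S', η', p', x')`
related by TORELLI DATA: an isomorphism `f : S ≅ S'`, a sign `ε = ±1` and a word
`w = s_{u₁} ∘ ⋯ ∘ s_{u_k}` in reflections along lattice vectors orthogonal to `x` (for the global
Torelli theorem — Huybrechts Ch. 7 Thm. 5.3 with Ch. 8 Cor. 2.9, NOT in the tree — this is what two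
marked projective K3 surfaces with the same period line come with: `±(η⁻¹ ∘ η')` composed with an
element of the Weyl group is effective, hence induced by a unique isomorphism), with
`η ∘ f^* = ε · w ∘ η'`. Then, GRANTED the existing named facts `Huybrechts_K3_hodgeTypes_H2` and
`lefschetzOneOne_rational` (and NOT the multiplicativity leaf: words in reflections compose without
the moving lemma, `corr_prod_k3ReflectionC_of_mem_algebraicClasses`), every reflective `η⁻¹ ∘ s_v ∘ η'` with `(v.v) ≠ 0`, `s_v(x') ∈ ℂ x` is
`[γ]_*^μ` for an algebraic `γ`: `w` fixes `x` and `w⁻¹ = s_{u_k} ∘ ⋯ ∘ s_{u₁}`, so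
`η' = ε · w⁻¹ ∘ η ∘ f^*`; the period pulls back to a `(2,0)`-class, so `x' = (ε s) x` with
`ε s ≠ 0`, whence `(v.x) = 0` (`k3Form_eq_zero_of_k3ReflectionC_eq_smul`); and
`η⁻¹ ∘ s_v ∘ η' = ε · η⁻¹ ∘ (s_v ∘ s_{u_k} ∘ ⋯ ∘ s_{u₁}) ∘ η ∘ f^*` is
`corr_smul_prod_k3ReflectionC_map_iso`. What remains of the leaf beyond this theorem and global
Torelli is exactly the case `(v.x') ≠ 0` (two different periods): Buskin's Prop. 6.1.
[cite: Buskin2019, §1 (Introduction: the Torelli case), §6.2 Prop. 6.2 and proof of Thm. 1.1]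
[cite: Huybrechts2016K3, Ch. 7 Thm. 5.3 and Ch. 8 Cor. 2.9] [cite: Huybrechts2019, §1.1 Thm. 1.1] -/
theorem Buskin2019_reflectiveHodgeIsometry_algebraic_of_torelliData
    (hH : Huybrechts_K3_hodgeTypes_H2) (hL11 : lefschetzOneOne_rational)
    (μ : OrientationFamily) (S S' : Motives.SchemeOver ℂ) (hS : IsK3Surface S) (hS' : IsK3Surface S')
    (η : complexBetti S (2 * 1) ≃ₗ[ℂ] (K3Index → ℂ)) (p : complexBetti S (2 * 2)) (x : K3Index → ℂ)
    (η' : complexBetti S' (2 * 1) ≃ₗ[ℂ] (K3Index → ℂ)) (p' : complexBetti S' (2 * 2))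
    (x' : K3Index → ℂ) (f : S ≅ S') (ε : ℂ) (hε : ε = 1 ∨ ε = -1) (l : List (K3Index → ℤ))
    (hl : ∀ u ∈ l, k3Form (fun i => (u i : ℂ)) x = 0)
    (hf : ∀ y : complexBetti S' (2 * 1),
      η (complexBetti.map f.hom (2 * 1) y) = ε • (l.map k3ReflectionC).prod (η' y)) :
    MarkedK3[S, η, p, x] → PeriodPt[x] → MarkedK3[S', η', p', x'] → PeriodPt[x'] →
    ∀ v : K3Index → ℤ, ∑ i, ∑ j, v i * k3Gram i j * v j ≠ 0 →
    (∃ t : ℂ, k3ReflectionC v x' = t • x) →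
    ∃ γ ∈ algebraicClasses (MonoidalCategoryStruct.tensorObj S S') 2,
      ∀ y : complexBetti S' (2 * 1),
        η.symm (k3ReflectionC v (η' y)) = Corr[μ, S, S', hS, hS' ; γ, y] := by
  intro hm hx hm' hx' v hv ht
  obtain ⟨t, ht⟩ := ht
  have hε0 : ε ≠ 0 := by rcases hε with rfl | rfl <;> norm_num
  have hεε : ε * ε = 1 := by rcases hε with rfl | rfl <;> norm_num
  -- `w = ∏ s_u` fixes `x`, and `w ∘ w.reverse = 1`
  set w : Module.End ℂ (K3Index → ℂ) := (l.map k3ReflectionC).prod with hw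
  set w' : Module.End ℂ (K3Index → ℂ) := (l.reverse.map k3ReflectionC).prod with hw'
  have hww' : w * w' = 1 := by
    rw [hw, hw']
    clear hl hf hw hw'
    induction l with
    | nil => simp
    | cons u l ih =>
      rw [List.map_cons, List.prod_cons, List.reverse_cons, List.map_append, List.prod_append,
        List.map_singleton, List.prod_singleton, mul_assoc, ← mul_assoc (l.map k3ReflectionC).prod, ih,
        one_mul, k3ReflectionC_mul_self]
  have hw'w : w' * w = 1 := by
    rw [hw, hw']
    clear hl hf hw hw' hww'
    induction l with
    | nil => simp
    | cons u l ih =>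
      rw [List.map_cons, List.prod_cons, List.reverse_cons, List.map_append, List.prod_append,
        List.map_singleton, List.prod_singleton, mul_assoc, ← mul_assoc (k3ReflectionC u),
        k3ReflectionC_mul_self, one_mul, ih]
  have hwx : w x = x := by
    rw [hw]
    clear hf hw hw' hww' hw'w
    induction l with
    | nil => simp
    | cons u l ih =>
      rw [List.map_cons, List.prod_cons, Module.End.mul_apply,
        ih fun u' hu' => hl u' (List.mem_cons_of_mem u hu'), k3ReflectionC_apply,
        hl u List.mem_cons_self, mul_zero, zero_smul, sub_zero]
  -- `η'` in terms of `η ∘ f^*`: `η' y = ε • w' (η (f^* y))`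
  have hη' : ∀ y : complexBetti S' (2 * 1),
      η' y = ε • w' (η (complexBetti.map f.hom (2 * 1) y)) := fun y => by
    rw [hf y, map_smul, smul_smul, hεε, one_smul, ← Module.End.mul_apply, hw'w, Module.End.one_apply]
  -- the period: `x' = r • x`
  obtain ⟨B, -⟩ := hS.2.2
  have h20 : IsOfHodgeType 2 S (2 * 1) 2 0 (complexBetti.map f.hom (2 * 1) (η'.symm x')) :=
    hm'.2.2.2.2.1.map_of_le hS.isSmoothProjective hS'.isSmoothProjective B f.hom le_rfl
  obtain ⟨s, hs⟩ := hm.2.2.2.2.2 _ h20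
  have hx's : x' = (ε * s) • x := by
    have h := hη' (η'.symm x')
    rw [η'.apply_symm_apply, hs, map_smul, LinearEquiv.apply_symm_apply, map_smul, smul_smul] at h
    rw [h]
    -- `w' x = x`
    congr 1
    have h2 : w' (w x) = x := by rw [← Module.End.mul_apply, hw'w, Module.End.one_apply]
    rwa [hwx] at h2
  have hx0 : x ≠ 0 := by
    rintro rfl
    have h := hx.2.1
    rw [k3Form_zero_right, Complex.zero_re] at h
    exact lt_irrefl _ h
  have hr0 : ε * s ≠ 0 := by
    intro h0
    rw [h0, zero_smul] at hx's
    have h := hx'.2.1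
    rw [hx's, k3Form_zero_right, Complex.zero_re] at h
    exact lt_irrefl _ h
  -- hence `(v.x) = 0`
  have hvx : k3Form (fun i => (v i : ℂ)) x = 0 := by
    refine k3Form_eq_zero_of_k3ReflectionC_eq_smul hx.1 hv ⟨(ε * s)⁻¹ * t, ?_⟩
    rw [hx's, map_smul] at ht
    rw [← smul_smul, ← ht, smul_smul, inv_mul_cancel₀ hr0, one_smul]
  -- assemble with the list `v :: l.reverse` and the scalar `ε`
  obtain ⟨γ, hγ, h⟩ := corr_smul_prod_k3ReflectionC_map_iso hH hL11 μ hS hS' η p hm.2.2.1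
    hm.2.2.2.1 hm.2.2.2.2.1 hx0 f ε (v :: l.reverse)
    (fun u hu => by
      rcases List.mem_cons.1 hu with rfl | hu
      · exact hvx
      · exact hl u (List.mem_reverse.1 hu))
  refine ⟨γ, hγ, fun y => ?_⟩
  rw [← h y, hη' y, map_smul, map_smul, List.map_cons, List.prod_cons, Module.End.mul_apply, ← hw']


/-- **Algebraicity from marked Torelli data, general form.** For a marked K3 surface `(S, η, p, x)`
(`η⁻¹(x) ≠ 0` of type `(2,0)`), a second K3 surface `S'` with a marking `η'`, ANY lattice operator
`g` on `Λ_ℂ`, and Torelli data RELATIVE TO `g` — an isomorphism `f : S ≅ S'`, a sign `ε = ±1` and a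
word `w = s_{u₁} ∘ ⋯ ∘ s_{u_k}` in reflections along lattice vectors orthogonal to `x` with
`η ∘ f^* = ε · w ∘ g ∘ η'` — the operator `η⁻¹ ∘ g ∘ η' = ε · η⁻¹ ∘ w⁻¹ ∘ η ∘ f^*` from
`H²(S'(ℂ); ℂ)` to `H²(S(ℂ); ℂ)` is `[γ]_*^μ` for an algebraic `γ ∈ N² H⁴((S ⊗ S')(ℂ); ℂ)`
(`corr_smul_prod_k3ReflectionC_map_iso` with the reversed word, which inverts `w`), GRANTED the existing named facts
`Huybrechts_K3_hodgeTypes_H2` and `lefschetzOneOne_rational`. By the global Torelli theorem in its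
strong form (Huybrechts Ch. 7 Thm. 5.3: EVERY Hodge isometry `ψ : H²(X, ℤ) ≅ H²(X', ℤ)` with
`ψ(𝒦_X) ∩ 𝒦_{X'} ≠ ∅` is `f^*`, with Ch. 8 Cor. 2.9 and a sign to reach the Kähler condition — NOT in
the tree) such data exist for every INTEGRAL `g ∈ O(Λ)` carrying the period line of `S'` to that of
`S`: `g = 1` (same periods) and `g = s_v` with `(v.v) = ±2` (integral reflections) are the cases of
the leaf `Buskin2019_reflectiveHodgeIsometry_algebraic` thus reduced to global Torelli; the residual
case — non-integral reflections `s_v` with `(v.x') ≠ 0`, Buskin's `n`-cyclic isometries with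
`n ≥ 2` — is Mukai's theorem and Prop. 6.1. [cite: Buskin2019, §1 (Introduction: the Torelli case), §3 Def. 3.1 / Example 3.2, §6.2]
[cite: Huybrechts2016K3, Ch. 7 Thm. 5.3 and Ch. 8 Cor. 2.9] [cite: Huybrechts2019, §1.1 Thm. 1.1] -/
theorem corr_of_markedTorelliData
    (hH : Huybrechts_K3_hodgeTypes_H2) (hL11 : lefschetzOneOne_rational)
    (μ : OrientationFamily) (hS : IsK3Surface S) (hS' : IsK3Surface S')
    (η : complexBetti S (2 * 1) ≃ₗ[ℂ] (K3Index → ℂ)) (p : complexBetti S (2 * 2)) {x : K3Index → ℂ}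
    (hint : ∀ c : complexBetti S (2 * 1), IsIntegralClass c ↔ ∃ v : K3Index → ℤ, η c = fun i => (v i : ℂ))
    (hcup : ∀ a b : complexBetti S (2 * 1),
      cupProduct (rfl : 2 * 1 + 2 * 1 = 2 * 2) a b = k3Form (η a) (η b) • p)
    (hσ : IsOfHodgeType 2 S (2 * 1) 2 0 (η.symm x)) (hx0 : x ≠ 0)
    (η' : complexBetti S' (2 * 1) ≃ₗ[ℂ] (K3Index → ℂ)) (g : Module.End ℂ (K3Index → ℂ))
    (f : S ≅ S') (ε : ℂ) (hε : ε = 1 ∨ ε = -1) (l : List (K3Index → ℤ))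
    (hl : ∀ u ∈ l, k3Form (fun i => (u i : ℂ)) x = 0)
    (hf : ∀ y : complexBetti S' (2 * 1),
      η (complexBetti.map f.hom (2 * 1) y) = ε • (l.map k3ReflectionC).prod (g (η' y))) :
    ∃ γ ∈ algebraicClasses (MonoidalCategoryStruct.tensorObj S S') 2,
      ∀ y : complexBetti S' (2 * 1), η.symm (g (η' y)) = Corr[μ, S, S', hS, hS' ; γ, y] := by
  have hεε : ε * ε = 1 := by rcases hε with rfl | rfl <;> norm_num
  -- the reversed word inverts the word (`s_u ∘ s_u = 1`)
  have hw'w : (l.reverse.map k3ReflectionC).prod * (l.map k3ReflectionC).prod = 1 := by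
    clear hf hl
    induction l with
    | nil => simp
    | cons u l ih =>
      rw [List.map_cons, List.prod_cons, List.reverse_cons, List.map_append, List.prod_append,
        List.map_singleton, List.prod_singleton, mul_assoc, ← mul_assoc (k3ReflectionC u),
        k3ReflectionC_mul_self, one_mul, ih]
  obtain ⟨γ, hγ, h⟩ := corr_smul_prod_k3ReflectionC_map_iso hH hL11 μ hS hS' η p hint hcup hσ hx0 f ε
    l.reverse (fun u hu => hl u (List.mem_reverse.1 hu))
  refine ⟨γ, hγ, fun y => ?_⟩
  rw [← h y, hf y, map_smul, map_smul, smul_smul, hεε, one_smul, ← Module.End.mul_apply, hw'w,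
    Module.End.one_apply]

/-- **Buskin's Prop. 6.2 for reflective isometries, from marked Torelli data relative to `s_v`.** In
the notation of the named fact `Buskin2019_reflectiveHodgeIsometry_algebraic`: if the pair
`(S, η)`, `(S', η')` admits Torelli data RELATIVE TO `s_v` — `f : S ≅ S'`, `ε = ±1`, a word `w` in
reflections along lattice vectors orthogonal to `x` with `η ∘ f^* = ε · w ∘ s_v ∘ η'` (which the
strong global Torelli theorem supplies whenever `s_v` is INTEGRAL, `(v.v) = ±2`, the Hodge condition
`s_v(x') ∈ ℂ x` being the leaf's hypothesis) — then `η⁻¹ ∘ s_v ∘ η' = [γ]_*^μ` for an algebraic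
`γ ∈ N² H⁴((S ⊗ S')(ℂ); ℂ)`, GRANTED `Huybrechts_K3_hodgeTypes_H2` and `lefschetzOneOne_rational`
(`corr_of_markedTorelliData` with `g = s_v`; the period, `(v.v) ≠ 0` and `s_v(x') ∈ ℂ x` are not
even used). [cite: Buskin2019, §1 (Introduction) and §6.2 Prop. 6.2] [cite: Huybrechts2016K3, Ch. 7 Thm. 5.3 and Ch. 8 Cor. 2.9] -/
theorem Buskin2019_reflectiveHodgeIsometry_algebraic_of_markedTorelliData
    (hH : Huybrechts_K3_hodgeTypes_H2) (hL11 : lefschetzOneOne_rational)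
    (μ : OrientationFamily) (S S' : Motives.SchemeOver ℂ) (hS : IsK3Surface S) (hS' : IsK3Surface S')
    (η : complexBetti S (2 * 1) ≃ₗ[ℂ] (K3Index → ℂ)) (p : complexBetti S (2 * 2)) (x : K3Index → ℂ)
    (η' : complexBetti S' (2 * 1) ≃ₗ[ℂ] (K3Index → ℂ)) (p' : complexBetti S' (2 * 2))
    (x' : K3Index → ℂ) (v : K3Index → ℤ) (f : S ≅ S') (ε : ℂ) (hε : ε = 1 ∨ ε = -1)
    (l : List (K3Index → ℤ)) (hl : ∀ u ∈ l, k3Form (fun i => (u i : ℂ)) x = 0)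
    (hf : ∀ y : complexBetti S' (2 * 1), η (complexBetti.map f.hom (2 * 1) y) =
      ε • (l.map k3ReflectionC).prod (k3ReflectionC v (η' y))) :
    MarkedK3[S, η, p, x] → PeriodPt[x] → MarkedK3[S', η', p', x'] → PeriodPt[x'] →
    ∑ i, ∑ j, v i * k3Gram i j * v j ≠ 0 → (∃ t : ℂ, k3ReflectionC v x' = t • x) →
    ∃ γ ∈ algebraicClasses (MonoidalCategoryStruct.tensorObj S S') 2,
      ∀ y : complexBetti S' (2 * 1),
        η.symm (k3ReflectionC v (η' y)) = Corr[μ, S, S', hS, hS' ; γ, y] := by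
  intro hm hx _ _ _ _
  have hx0 : x ≠ 0 := by
    rintro rfl
    have h := hx.2.1
    rw [k3Form_zero_right, Complex.zero_re] at h
    exact lt_irrefl _ h
  exact corr_of_markedTorelliData hH hL11 μ hS hS' η p hm.2.2.1 hm.2.2.2.1 hm.2.2.2.2.1 hx0 η'
    (k3ReflectionC v) f ε hε l hl hf

end TorelliCase

end Literature.AlgebraicGeometry.Surfaces

end
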